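import Mathlib.Analysis.SpecialFunctions.SmoothTransition
import Mathlib.Analysis.Calculus.Deriv.MeanValue
import Mathlib.Analysis.Calculus.ContDiff.Operations
import Mathlib.Topology.Order.IntermediateValue
import Mathlib.Order.Hom.Basic
import Mathlib.Topology.Homotopy.Equiv
import Literature.Topology.FourManifolds.BoundaryFlowout
import Literature.Topology.FourManifolds.RegularSlabField
import Literature.Topology.FourManifolds.Handles
import Literature.Topology.FourManifolds.ThickenedSublevel
import Literature.Topology.FourManifolds.RegularDomainMaps
import Literature.Topology.FourManifolds.SmoothEmbeddingComp
import Literature.Topology.FourManifolds.GluingProofs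
import Literature.Topology.FourManifolds.RegularIntervalBoundary
import Literature.Topology.FourManifolds.DoubleThickening
import Literature.Topology.FourManifolds.MazurDoubleReduction
import HarnessLib

/-!
# The double of a compact manifold with boundary bounds its counted thickening — proofs

Topic `Literature/Topology/FourManifolds`; proofs file next to `DoubleThickening.lean` (named fact
`Literature.Topology.FourManifolds.exists_thickening_of_isDouble`) and `MazurDoubleReduction.lean`
(named fact `Literature.Topology.FourManifolds.exists_countedThickening_of_isDouble`, the same with
handle COUNTS).  **Both facts are discharged here** (`exists_thickening_of_isDouble_holds`,
`exists_countedThickening_of_isDouble_holds`); everything in this file is proved, no definition of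
a notion and no named fact is introduced (the `def`s are the explicit maps of the construction).

## The statement proved (`DoubleThickening.exists_counted_thickening`)

Let `W` be a compact smooth `(n+1)`-manifold with boundary (Hausdorff, second countable, model
`𝓡∂ (n + 1)`), `f : W → ℝ` a Morse function adapted to `∂W` (`IsMorseAdapted`: `f = 1` and
`df ≠ 0` on `∂W`, `f < 1` inside), `b` a boundary datum of `W` and `P` a smooth `(n+1)`-manifold
which is a double of `W` (`IsDouble b (𝓡 (n + 1)) P`, `Gluing.lean`).  Then there is a compact
smooth `(n+2)`-manifold with boundary `V` with `V ≃ₕ W`, with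
`HasHandleDecomposition (n + 1) V (k ↦ #Crit_k f)` (one handle of index `k` for each critical point
of `f` of index `k`; hence a `k`-handlebody if `f` has indices `≤ k`), and a smooth embedding
`φ : P → V` onto `∂V`.  This is the smooth content of "`D(W) = ∂(W × I)` and the handle structure
of `W` stabilises to one of `W × I` with the same numbers of handles of each index"
(Freedman–Gompf–Morrison–Walker 2010, proof of Fact 2; Kirby 1989, Ch. I §2 and p. 18; Kosinski
1993, VI §5 for the double).

## The construction (Milnor's `f + s²`, no corners)

Instead of straightening the corners of `W × [0, 1]` we realise the thickening directly as a
regular sublevel set, as in the companion file `ThickenedSublevel.lean` (accepted): inside the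
boundaryless `(n+2)`-manifold `Int W × ℝ` the set `V = {(w, s) : f w + s² ≤ 1 - ε}` is a compact
manifold with boundary `C = ∂V = {f w + s² = 1 - ε}` carrying the Morse function `f + s²` adapted
to `∂V`, whose critical points are those of `f` (on `s = 0`) with the same indices
(`Thickening.hasHandleDecomposition`; `ε > 0` is chosen below all of `1 - (critical values)`, so
that all critical points of `f` are counted, §Existence).  What this file adds is the
identification of `∂V` with the double of `W` and the homotopy equivalence `V ≃ₕ W`:

* §Flowout, §Profile, §Push.  Let `g = 1 - f` (a boundary-defining function, `g = 0` exactly on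
  `∂W`) with Milnor's flow-out `Fl` of `∂W` along a field `ξ` with `ξ(g) = 1` near `∂W` and the
  retraction `ret` (`BoundaryFlowout.lean`; Milnor 1965, proof of Thm. 3.4): `g (Fl z t) = g z + t`.
  We prove the joint smoothness of `(z, t) ↦ Fl z t` on `{g < a} × [0, a]` and of `ret` on
  `{g < a}`.  A smooth profile `ν_ε(s) = s + χ(s)(ε + s² - s)` (`= s` near `0`, `= ε + s²` for
  `s ≥ ε/2`, `ν' > 0`) with inverse `μ_ε` and defect `θ_ε = ε + s² - ν_ε ≥ 0` defines the
  *push* `R(w) = Fl (ret w) (g w + θ_ε(μ_ε(g w)))` (the identity deep inside), a smooth self-map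
  of `W` homotopic to the identity, and the coordinate `S = μ_ε ∘ g` (`= g` near `∂W`).
* §Sheets.  The two *sheets* `j_σ(w) = (R w, σ S w)`, `σ = ±1`, land in `C`
  (`f (R w) + S(w)² = 1 - ε` by construction) and are smooth into `C` (smooth maps into the
  interior, into a regular domain, into the boundary: `InteriorManifold`, `RegularDomainMaps`).
* §FlowBack, §Regular, §Pieces.  The *flow-back* `Ψ_σ(q, s) = Fl (ret q) (ν_ε(σ s))` inverts
  `j_σ` on `U_σ = {σ s ≥ 0} ⊆ C`; `s = 0` is a regular level of the height `s : C → ℝ` (chain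
  rule along `j_σ`, `dg ≠ 0` on `∂W`), so `U_σ` is a regular domain of `C` and
  `j_σ : W ≅ U_σ` is a diffeomorphism (the flow-back is smooth on `U_σ` because the flow-out is
  jointly smooth for nonnegative times); hence `j_σ : W → C` is a smooth embedding
  (`SmoothEmbeddingComp.lean`).
* §Double.  `j₊(W) ∪ j₋(W) = C` and `j₊ a = j₋ a' ↔ a = a' ∈ ∂W`: `C` is a double of `W`
  (`IsDouble b (𝓡 (n + 1)) C`), so every double `P` of `W` is diffeomorphic to `C` by the
  uniqueness of gluings (`nonempty_diffeomorph_of_isBoundaryGluing_holds`, `GluingProofs.lean`;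
  Hirsch 1976, Thm. 8.2.1) and embeds onto `∂V`.
* §HomotopyEquiv.  `r(w, s) = w` and `i(w) = (R w, 0)` are homotopy inverse: `r ∘ i = R ≃ id`
  by the push homotopy, and `(w, s) ↦ (H_t w, (1 - t) s)` deforms `id_V` to `i ∘ r` inside `V`
  (the level `g` only increases along the push).

## References

* M. Freedman, R. Gompf, S. Morrison, K. Walker, *Man and machine thinking about the smooth
  4-dimensional Poincaré conjecture*, Quantum Topol. 1 (2010), proof of Fact 2.
  [FreedmanGompfMorrisonWalker2010]
* R. Kirby, *The topology of 4-manifolds*, LNM 1374 (1989), Ch. I §2, p. 18. [Kirby1989]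
* A. A. Kosinski, *Differential Manifolds* (1993), VI §5 (the double). [Kosinski1993]
* J. Milnor, *Lectures on the h-cobordism theorem* (1965), §2–§3 (`f + s²`, collars, proof of
  Thm. 3.4). [MilnorHCobordism1965]
* J. Milnor, *Morse theory* (1963), Thm. 3.1 (regular sublevel sets). [Milnor1963]
* M. W. Hirsch, *Differential Topology* (1976), Thm. 8.2.1 (uniqueness of gluing). [HirschDT1976]
-/

open Set Function Filter Metric
open scoped Manifold ContDiff Topology ContinuousMap

noncomputable section

namespace Literature.Topology.FourManifolds

universe u

/-- Local notation: `𝔼 n` is the model Euclidean space `EuclideanSpace ℝ (Fin n)`. -/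
local notation "𝔼 " n:arg => EuclideanSpace ℝ (Fin n)

/-! ### Joint smoothness of the flow-out and of the retraction -/

section Flowout

variable {n : ℕ} {W : Type u} [TopologicalSpace W] [T2Space W]
  [ChartedSpace (EuclideanHalfSpace (n + 1)) W] [IsManifold (𝓡∂ (n + 1)) ∞ W]
  {D : FlowoutInput n W} (Γ : D.Cover)

namespace FlowoutInput.Cover

/-- **The flow-out is jointly smooth** on `{f < a} × [0, a]`: locally it is the flow curve of a
fixed chart box (`Fl_eq_of_mem_dom`, `contMDiffOn_curve`).
[cite: MilnorHCobordism1965, proof of Thm. 3.4] -/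
theorem contMDiffOn_Fl :
    ContMDiffOn ((𝓡∂ (n + 1)).prod 𝓘(ℝ, ℝ)) (𝓡∂ (n + 1)) ∞ (fun p : W × ℝ => Γ.Fl p.1 p.2)
      ({z | D.f z < Γ.a} ×ˢ Icc 0 Γ.a) := by
  apply contMDiffOn_of_locally_contMDiffOn
  rintro ⟨z₀, t₀⟩ ⟨hz₀, -⟩
  have hz₀' : D.f z₀ ≤ Γ.a := le_of_lt hz₀
  obtain ⟨hy, hzd⟩ := Γ.centre_spec hz₀'
  set y := Γ.centre z₀ with hydef
  set C := Γ.bx y hy with hC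
  refine ⟨C.dom ×ˢ univ, C.isOpen_dom.prod isOpen_univ, ⟨hzd, mem_univ _⟩, ?_⟩
  have hsub : {z | D.f z < Γ.a} ×ˢ Icc 0 Γ.a ∩ C.dom ×ˢ univ ⊆ C.dom ×ˢ Icc 0 C.box.ε := by
    rintro ⟨z, t⟩ ⟨⟨-, ht⟩, hz, -⟩
    exact ⟨hz, ht.1, ht.2.trans (Γ.a_le_ε y hy)⟩
  refine ((Γ.contMDiffOn_curve y hy).mono hsub).congr ?_
  rintro ⟨z, t⟩ ⟨⟨hz, ht⟩, hzd, -⟩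
  exact Γ.Fl_eq_of_mem_dom hy (le_of_lt hz) hzd ⟨by linarith [D.f_nonneg z, ht.1], ht.2⟩

/-- **The retraction `ret` is smooth on `{f < a}`** (`contMDiffOn_curve_neg` in a fixed box).
[cite: MilnorHCobordism1965, proof of Thm. 3.4] -/
theorem contMDiffOn_ret_lt : ContMDiffOn (𝓡∂ (n + 1)) (𝓡∂ (n + 1)) ∞ Γ.ret {z | D.f z < Γ.a} := by
  apply contMDiffOn_of_locally_contMDiffOn
  intro z₀ hz₀
  have hz₀' : D.f z₀ ≤ Γ.a := le_of_lt hz₀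
  obtain ⟨hy, hzd⟩ := Γ.centre_spec hz₀'
  set y := Γ.centre z₀ with hydef
  set C := Γ.bx y hy with hC
  refine ⟨C.dom, C.isOpen_dom, hzd, ?_⟩
  have h1 : ContMDiffOn (𝓡∂ (n + 1)) (𝓡∂ (n + 1)) ∞ (fun z => C.curve z (-D.f z))
      ({z | D.f z < Γ.a} ∩ C.dom) :=
    (Γ.contMDiffOn_curve_neg y hy).mono fun z hz => ⟨hz.2, lt_of_lt_of_le hz.1 (Γ.a_le_ε y hy)⟩
  refine h1.congr fun z hz => ?_
  show Γ.Fl z (-D.f z) = C.curve z (-D.f z)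
  exact Γ.Fl_eq_of_mem_dom hy (le_of_lt hz.1) hz.2 ⟨le_rfl, by linarith [D.f_nonneg z, Γ.a_pos]⟩

omit [T2Space W] in
/-- The retraction of a point of `{f ≤ a}` satisfies `f (ret z) ≤ a`. [folklore] -/
theorem f_ret_le {z : W} (hz : D.f z ≤ Γ.a) : D.f (Γ.ret z) ≤ Γ.a := by
  rw [Γ.f_ret hz]; exact Γ.a_pos.le

omit [T2Space W] in
/-- **Level of a point flowed out from the boundary**: `f (Fl (ret z) t) = t` for `t ∈ [0, a]`.
[folklore] -/
theorem f_Fl_ret {z : W} (hz : D.f z ≤ Γ.a) {t : ℝ} (ht : t ∈ Icc 0 Γ.a) :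
    D.f (Γ.Fl (Γ.ret z) t) = t := by
  rw [Γ.f_Fl (Γ.f_ret_le hz) (by rw [Γ.f_ret hz, neg_zero]; exact ht), Γ.f_ret hz, zero_add]

/-- Flowing out from the retraction does not change the retraction: `ret (Fl (ret z) t) = ret z`.
[folklore] -/
theorem ret_Fl_ret {z : W} (hz : D.f z ≤ Γ.a) {t : ℝ} (ht : t ∈ Icc 0 Γ.a) :
    Γ.ret (Γ.Fl (Γ.ret z) t) = Γ.ret z :=
  Γ.ret_Fl (Γ.f_ret hz) ht

end FlowoutInput.Cover

end Flowout

namespace DoubleThickening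

/-! ### Profile functions of one real variable -/

namespace Profile

/-- The cut-off `χ_ε`: `0` for `s ≤ ε/4`, `1` for `s ≥ ε/2`, monotone, smooth. [folklore] -/
def chi (ε s : ℝ) : ℝ := Real.smoothTransition ((s - ε / 4) / (ε / 4))

variable {ε : ℝ}

/-- `χ_ε = 0` on `(-∞, ε/4]`. [folklore] -/
theorem chi_eq_zero (hε : 0 < ε) {s : ℝ} (hs : s ≤ ε / 4) : chi ε s = 0 :=
  Real.smoothTransition.zero_of_nonpos (div_nonpos_of_nonpos_of_nonneg (by linarith) (by linarith))

/-- `χ_ε = 1` on `[ε/2, ∞)`. [folklore] -/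
theorem chi_eq_one (hε : 0 < ε) {s : ℝ} (hs : ε / 2 ≤ s) : chi ε s = 1 :=
  Real.smoothTransition.one_of_one_le ((one_le_div (by linarith)).2 (by linarith))

/-- `0 ≤ χ_ε`. [folklore] -/
theorem chi_nonneg (s : ℝ) : 0 ≤ chi ε s := Real.smoothTransition.nonneg _

/-- `χ_ε ≤ 1`. [folklore] -/
theorem chi_le_one (s : ℝ) : chi ε s ≤ 1 := Real.smoothTransition.le_one _

/-- `χ_ε` is monotone. [folklore] -/
theorem chi_monotone (hε : 0 < ε) : Monotone (chi ε) := fun s t hst =>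
  Real.smoothTransition.monotone (div_le_div_of_nonneg_right (by linarith) (by linarith))

/-- `χ_ε` is `C^∞`. [folklore] -/
theorem contDiff_chi : ContDiff ℝ ∞ (chi ε) :=
  Real.smoothTransition.contDiff.comp ((contDiff_id.sub contDiff_const).div_const _)

/-- `χ_ε' ≥ 0`. [folklore] -/
theorem deriv_chi_nonneg (hε : 0 < ε) (s : ℝ) : 0 ≤ deriv (chi ε) s :=
  (chi_monotone hε).deriv_nonneg

/-- The level profile `ν_ε(s) = s + χ_ε(s) (ε + s² - s)`: equal to `s` near `0`, to `ε + s²` for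
`s ≥ ε/2`, a smooth increasing diffeomorphism of `ℝ`. [folklore] -/
def nu (ε s : ℝ) : ℝ := s + chi ε s * (ε + s ^ 2 - s)

/-- The push time `θ_ε(s) = ε + s² - ν_ε(s) = (1 - χ_ε(s)) (ε + s² - s) ≥ 0`, vanishing for
`s ≥ ε/2`. [folklore] -/
def theta (ε s : ℝ) : ℝ := ε + s ^ 2 - nu ε s

/-- `ν_ε + θ_ε = ε + s²`. [folklore] -/
theorem nu_add_theta (s : ℝ) : nu ε s + theta ε s = ε + s ^ 2 := by unfold theta; ring

/-- `θ_ε(s) = (1 - χ_ε(s)) (ε + s² - s)`. [folklore] -/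
theorem theta_eq (s : ℝ) : theta ε s = (1 - chi ε s) * (ε + s ^ 2 - s) := by
  unfold theta nu; ring

/-- `ν_ε(s) = s` for `s ≤ ε/4`. [folklore] -/
theorem nu_eq_self (hε : 0 < ε) {s : ℝ} (hs : s ≤ ε / 4) : nu ε s = s := by
  unfold nu; rw [chi_eq_zero hε hs]; ring

/-- `ν_ε(s) = ε + s²` for `s ≥ ε/2`. [folklore] -/
theorem nu_eq_sq (hε : 0 < ε) {s : ℝ} (hs : ε / 2 ≤ s) : nu ε s = ε + s ^ 2 := by
  unfold nu; rw [chi_eq_one hε hs]; ring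

/-- `θ_ε(s) = 0` for `s ≥ ε/2`. [folklore] -/
theorem theta_eq_zero (hε : 0 < ε) {s : ℝ} (hs : ε / 2 ≤ s) : theta ε s = 0 := by
  rw [theta, nu_eq_sq hε hs]; ring

/-- `ν_ε(0) = 0`. [folklore] -/
theorem nu_zero (hε : 0 < ε) : nu ε 0 = 0 := nu_eq_self hε (by linarith)

/-- `θ_ε(0) = ε`. [folklore] -/
theorem theta_zero (hε : 0 < ε) : theta ε 0 = ε := by rw [theta, nu_zero hε]; ring

/-- `ν_ε` is `C^∞`. [folklore] -/
theorem contDiff_nu : ContDiff ℝ ∞ (nu ε) := by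
  unfold nu
  exact contDiff_id.add (contDiff_chi.mul ((contDiff_const.add (contDiff_id.pow 2)).sub contDiff_id))

/-- `θ_ε` is `C^∞`. [folklore] -/
theorem contDiff_theta : ContDiff ℝ ∞ (theta ε) := by
  unfold theta
  exact (contDiff_const.add (contDiff_id.pow 2)).sub contDiff_nu

/-- `θ_ε ≥ 0` on `[0, ∞)` when `ε ≤ 1`... in fact for all `s` with `ε + s² - s ≥ 0` or `χ = 1`;
we only need `0 ≤ s`: for `s ≤ ε/2`, `ε + s² - s ≥ ε/2 > 0`; for `s ≥ ε/2`, `θ = 0`. [folklore] -/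
theorem theta_nonneg (hε : 0 < ε) (s : ℝ) : 0 ≤ theta ε s := by
  rcases le_or_gt (ε / 2) s with h | h
  · rw [theta_eq_zero hε h]
  · rw [theta_eq]
    exact mul_nonneg (by linarith [chi_le_one (ε := ε) s]) (by nlinarith)

/-- `θ_ε(s) ≤ ε + ε²/4` for `s ≥ 0`. [folklore] -/
theorem theta_le (hε : 0 < ε) {s : ℝ} (hs : 0 ≤ s) : theta ε s ≤ ε + ε ^ 2 / 4 := by
  rcases le_or_gt (ε / 2) s with h | h
  · rw [theta_eq_zero hε h]; positivity
  · rw [theta_eq]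
    have h1 : 0 ≤ 1 - chi ε s := by linarith [chi_le_one (ε := ε) s]
    have h2 : 1 - chi ε s ≤ 1 := by linarith [chi_nonneg (ε := ε) s]
    have h3 : ε + s ^ 2 - s ≤ ε + ε ^ 2 / 4 := by nlinarith
    have h4 : 0 ≤ ε + s ^ 2 - s := by nlinarith
    calc (1 - chi ε s) * (ε + s ^ 2 - s) ≤ 1 * (ε + s ^ 2 - s) := by gcongr
      _ ≤ ε + ε ^ 2 / 4 := by linarith

/-- The derivative of `ν_ε`. [folklore] -/
theorem hasDerivAt_nu (s : ℝ) :
    HasDerivAt (nu ε) (1 + (deriv (chi ε) s * (ε + s ^ 2 - s) + chi ε s * (2 * s - 1))) s := by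
  unfold nu
  have hchi : HasDerivAt (chi ε) (deriv (chi ε) s) s :=
    (contDiff_chi.differentiable (by simp) s).hasDerivAt
  have hp : HasDerivAt (fun s => ε + s ^ 2 - s) (2 * s - 1) s :=
    (((hasDerivAt_pow 2 s).const_add ε).sub (hasDerivAt_id s)).congr_deriv (by simp)
  exact (hasDerivAt_id s).add (hchi.mul hp) |>.congr_deriv (by simp)

/-- `χ_ε' = 0` on `(ε/2, ∞)`. [folklore] -/
theorem deriv_chi_eq_zero_of_lt (hε : 0 < ε) {s : ℝ} (hs : ε / 2 < s) : deriv (chi ε) s = 0 := by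
  have h : chi ε =ᶠ[nhds s] fun _ => (1 : ℝ) := by
    filter_upwards [Ioi_mem_nhds hs] with t ht using chi_eq_one hε ht.le
  rw [h.deriv_eq]; simp

/-- `ν_ε' > 0` everywhere (for `ε > 0`). [folklore] -/
theorem deriv_nu_pos (hε : 0 < ε) (s : ℝ) : 0 < deriv (nu ε) s := by
  rw [(hasDerivAt_nu s).deriv]
  have hχ0 := chi_nonneg (ε := ε) s
  have hχ1 := chi_le_one (ε := ε) s
  have hχ' := deriv_chi_nonneg hε s
  rcases le_or_gt s (ε / 2) with h | h
  · -- `ε + s² - s ≥ ε/2 > 0`, `χ' ≥ 0`, and `(1 - χ) + 2 s χ > 0`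
    have hq : 0 < ε + s ^ 2 - s := by nlinarith
    have h3 : 0 ≤ deriv (chi ε) s * (ε + s ^ 2 - s) := mul_nonneg hχ' hq.le
    rcases le_or_gt s (ε / 4) with h4 | h4
    · rw [chi_eq_zero hε h4]; nlinarith
    · -- `s > ε/4 > 0`
      have hs0 : 0 < s := by linarith
      nlinarith
  · rw [deriv_chi_eq_zero_of_lt hε h, chi_eq_one hε h.le]
    nlinarith

/-- `ν_ε` is strictly increasing. [folklore] -/
theorem strictMono_nu (hε : 0 < ε) : StrictMono (nu ε) :=
  strictMono_of_deriv_pos (deriv_nu_pos hε)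

/-- `ν_ε` is continuous. [folklore] -/
theorem continuous_nu : Continuous (nu ε) := contDiff_nu.continuous

/-- `ν_ε` is surjective. [folklore] -/
theorem surjective_nu (hε : 0 < ε) : Surjective (nu ε) := by
  refine continuous_nu.surjective ?_ ?_
  · -- `ν(s) = ε + s²` for large `s`
    refine tendsto_atTop_mono' atTop ?_ tendsto_id
    filter_upwards [eventually_ge_atTop (ε / 2), eventually_ge_atTop (1 : ℝ)] with s hs hs1
    rw [nu_eq_sq hε hs]
    simp only [id_eq]
    nlinarith
  · refine tendsto_atBot_mono' atBot ?_ tendsto_id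
    filter_upwards [eventually_le_atBot (ε / 4)] with s hs
    rw [nu_eq_self hε hs]
    simp

/-- `ν_ε` as an order isomorphism of `ℝ`. [folklore] -/
def nuOrderIso (hε : 0 < ε) : ℝ ≃o ℝ := (strictMono_nu hε).orderIsoOfSurjective _ (surjective_nu hε)

/-- `ν_ε` as a homeomorphism of `ℝ`. [folklore] -/
def nuHomeomorph (hε : 0 < ε) : ℝ ≃ₜ ℝ := (nuOrderIso hε).toHomeomorph

/-- The homeomorphism `ν_ε` as a function. [folklore] -/
@[simp] theorem coe_nuHomeomorph (hε : 0 < ε) : ⇑(nuHomeomorph hε) = nu ε := rfl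

/-- The inverse profile `μ_ε = ν_ε⁻¹`. [folklore] -/
def mu (hε : 0 < ε) : ℝ → ℝ := (nuHomeomorph hε).symm

/-- `ν_ε ∘ μ_ε = id`. [folklore] -/
theorem nu_mu (hε : 0 < ε) (u : ℝ) : nu ε (mu hε u) = u := (nuHomeomorph hε).apply_symm_apply u

/-- `μ_ε ∘ ν_ε = id`. [folklore] -/
theorem mu_nu (hε : 0 < ε) (s : ℝ) : mu hε (nu ε s) = s := (nuHomeomorph hε).symm_apply_apply s

/-- `μ_ε` is `C^∞` (inverse function theorem in one variable, `ν_ε' > 0`). [folklore] -/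
theorem contDiff_mu (hε : 0 < ε) : ContDiff ℝ ∞ (mu hε) :=
  (nuHomeomorph hε).contDiff_symm_deriv (fun s => (deriv_nu_pos hε s).ne')
    (fun s => ((hasDerivAt_nu s).differentiableAt).hasDerivAt) contDiff_nu

/-- `μ_ε` is strictly increasing. [folklore] -/
theorem strictMono_mu (hε : 0 < ε) : StrictMono (mu hε) := (nuOrderIso hε).symm.strictMono

/-- `μ_ε(0) = 0`. [folklore] -/
theorem mu_zero (hε : 0 < ε) : mu hε 0 = 0 := by
  have := mu_nu hε 0
  rwa [nu_zero hε] at this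

/-- `μ_ε(u) ≥ 0 ↔ u ≥ 0`. [folklore] -/
theorem mu_nonneg_iff (hε : 0 < ε) {u : ℝ} : 0 ≤ mu hε u ↔ 0 ≤ u := by
  conv_lhs => rw [← mu_zero hε]
  exact (strictMono_mu hε).le_iff_le

/-- `μ_ε(u) > 0 ↔ u > 0`. [folklore] -/
theorem mu_pos_iff (hε : 0 < ε) {u : ℝ} : 0 < mu hε u ↔ 0 < u := by
  conv_lhs => rw [← mu_zero hε]
  exact (strictMono_mu hε).lt_iff_lt

/-- `μ_ε(u) = 0 ↔ u = 0`. [folklore] -/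
theorem mu_eq_zero_iff (hε : 0 < ε) {u : ℝ} : mu hε u = 0 ↔ u = 0 := by
  conv_lhs => rw [← mu_zero hε]
  exact (strictMono_mu hε).injective.eq_iff

/-- Near `0`, `μ_ε` is the identity: `μ_ε(u) = u` for `u ≤ ε/4`. [folklore] -/
theorem mu_eq_self (hε : 0 < ε) {u : ℝ} (hu : u ≤ ε / 4) : mu hε u = u := by
  have h := mu_nu hε u
  rwa [nu_eq_self hε hu] at h

/-- For `μ_ε(u) ≥ ε/2` one has `u = ε + μ_ε(u)²`. [folklore] -/
theorem eq_sq_of_le_mu (hε : 0 < ε) {u : ℝ} (hu : ε / 2 ≤ mu hε u) : u = ε + mu hε u ^ 2 := by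
  have h := nu_mu hε u
  rw [nu_eq_sq hε hu] at h
  exact h.symm

/-- Level bookkeeping: `ν(μ u) + θ(μ u) = ε + μ(u)²`, i.e. `u + θ(μ u) = ε + μ(u)²`. [folklore] -/
theorem add_theta_mu (hε : 0 < ε) (u : ℝ) : u + theta ε (mu hε u) = ε + mu hε u ^ 2 := by
  have h := nu_add_theta (ε := ε) (mu hε u)
  rwa [nu_mu hε] at h

/-- If `ε + ε²/4 < u` then `μ_ε(u) > ε/2`, so that `θ_ε(μ_ε u) = 0`. [folklore] -/
theorem lt_mu_of_lt (hε : 0 < ε) {u : ℝ} (hu : ε + ε ^ 2 / 4 < u) : ε / 2 < mu hε u := by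
  rw [← (strictMono_nu hε).lt_iff_lt, nu_mu hε, nu_eq_sq hε le_rfl]
  linarith

/-- `θ_ε(μ_ε(u)) = 0` for `u > ε + ε²/4`. [folklore] -/
theorem theta_mu_eq_zero (hε : 0 < ε) {u : ℝ} (hu : ε + ε ^ 2 / 4 < u) : theta ε (mu hε u) = 0 :=
  theta_eq_zero hε (lt_mu_of_lt hε hu).le

end Profile



/-! ### Push data: a flow-out, a cover and a small level shift `ε` -/

/-- **Push data** on a manifold with boundary `W`: a flow-out input `D` (boundary-defining
function `g = D.f` and inward field), a cover `Γ` by chart boxes of height `a` (so that the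
flow-out `Fl` and the retraction `ret` are defined on `{g ≤ a}`), and a level shift `ε` with
`0 < ε ≤ min(a, 1)/4`. [folklore] -/
structure PushData (n : ℕ) (W : Type u) [TopologicalSpace W]
    [ChartedSpace (EuclideanHalfSpace (n + 1)) W] [IsManifold (𝓡∂ (n + 1)) ∞ W] where
  /-- The flow-out input. -/
  D : FlowoutInput n W
  /-- The cover by chart boxes. -/
  Γ : D.Cover
  /-- The level shift. -/
  ε : ℝ
  /-- The level shift is positive. -/
  ε_pos : 0 < ε
  /-- The level shift is small: `ε ≤ min(a, 1)/4`. -/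
  ε_le : ε ≤ min Γ.a 1 / 4

namespace PushData

section Push

variable {n : ℕ} {W : Type u} [TopologicalSpace W]
  [ChartedSpace (EuclideanHalfSpace (n + 1)) W] [IsManifold (𝓡∂ (n + 1)) ∞ W]
  (T : PushData n W)

/-- `ε ≤ a/4`. [folklore] -/
theorem ε_le_quarter_a : T.ε ≤ T.Γ.a / 4 := by
  have := T.ε_le; have := min_le_left T.Γ.a 1; linarith

/-- `ε ≤ 1/4`. [folklore] -/
theorem ε_le_quarter : T.ε ≤ 1 / 4 := by
  have := T.ε_le; have := min_le_right T.Γ.a 1; linarith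

/-- The key numerical bound: `2 (ε + ε²/4) < a`. [folklore] -/
theorem two_mul_bound_lt : 2 * (T.ε + T.ε ^ 2 / 4) < T.Γ.a := by
  have h1 := T.ε_le_quarter_a
  have h2 := T.ε_le_quarter
  have h3 := T.ε_pos
  have ha := T.Γ.a_pos
  nlinarith

/-- `ε + ε²/4 < a`. [folklore] -/
theorem bound_lt : T.ε + T.ε ^ 2 / 4 < T.Γ.a := by
  have := T.two_mul_bound_lt; have := T.ε_pos; nlinarith

/-- `ε < a`. [folklore] -/
theorem ε_lt_a : T.ε < T.Γ.a := by
  have := T.bound_lt; have := T.ε_pos; nlinarith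

/-- The vertical coordinate `S(w) = μ_ε(g w)` of the sheet through `w` (`g = D.f` the
boundary-defining function). [folklore] -/
def sCoord (w : W) : ℝ := Profile.mu T.ε_pos (T.D.f w)

/-- The target level `ℓ(w) = ε + S(w)² = g w + θ_ε(μ_ε(g w))` of the push. [folklore] -/
def lev (w : W) : ℝ := T.ε + T.sCoord w ^ 2

/-- `ℓ(w) = g w + θ_ε(μ_ε(g w))`. [folklore] -/
theorem lev_eq (w : W) : T.lev w = T.D.f w + Profile.theta T.ε (Profile.mu T.ε_pos (T.D.f w)) := by
  unfold lev sCoord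
  exact (Profile.add_theta_mu T.ε_pos (T.D.f w)).symm

/-- `g w ≤ ℓ(w)`: the push moves up. [folklore] -/
theorem f_le_lev (w : W) : T.D.f w ≤ T.lev w := by
  rw [lev_eq]; linarith [Profile.theta_nonneg T.ε_pos (Profile.mu T.ε_pos (T.D.f w))]

/-- `ε ≤ ℓ(w)`. [folklore] -/
theorem ε_le_lev (w : W) : T.ε ≤ T.lev w := by
  unfold lev; nlinarith

/-- `0 < ℓ(w)`. [folklore] -/
theorem lev_pos (w : W) : 0 < T.lev w := lt_of_lt_of_le T.ε_pos (T.ε_le_lev w)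

/-- `S(w) ≥ 0`. [folklore] -/
theorem sCoord_nonneg (w : W) : 0 ≤ T.sCoord w :=
  (Profile.mu_nonneg_iff T.ε_pos).2 (T.D.f_nonneg w)

/-- `S(w) = 0` exactly on `∂W`. [folklore] -/
theorem sCoord_eq_zero_iff (w : W) : T.sCoord w = 0 ↔ w ∈ (𝓡∂ (n + 1)).boundary W := by
  rw [sCoord, Profile.mu_eq_zero_iff, T.D.f_eq_zero_iff]

/-- `S(w) > 0` exactly on the interior of `W`. [folklore] -/
theorem sCoord_pos_iff (w : W) : 0 < T.sCoord w ↔ w ∈ (𝓡∂ (n + 1)).interior W := by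
  rw [← ModelWithCorners.compl_boundary, mem_compl_iff, ← T.sCoord_eq_zero_iff,
    (T.sCoord_nonneg w).lt_iff_ne', ne_eq]

/-- `g = ν_ε ∘ S` (the defining relation of `S = μ_ε ∘ g`). [folklore] -/
theorem nu_sCoord (w : W) : Profile.nu T.ε (T.sCoord w) = T.D.f w :=
  Profile.nu_mu T.ε_pos _

/-- Near the boundary (`g w ≤ ε/4`) the coordinate `S` is `g` itself. [folklore] -/
theorem sCoord_eq_f {w : W} (hw : T.D.f w ≤ T.ε / 4) : T.sCoord w = T.D.f w :=
  Profile.mu_eq_self T.ε_pos hw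

/-- Deep inside (`g w > ε + ε²/4`) the target level is the level of `w` itself. [folklore] -/
theorem lev_eq_f_of_lt {w : W} (hw : T.ε + T.ε ^ 2 / 4 < T.D.f w) : T.lev w = T.D.f w := by
  rw [lev_eq, Profile.theta_mu_eq_zero T.ε_pos hw, add_zero]

/-- The target level stays below the height of the flow-out: `ℓ(w) < a` when `g w < a`.
[folklore] -/
theorem lev_lt_a {w : W} (hw : T.D.f w < T.Γ.a) : T.lev w < T.Γ.a := by
  rcases lt_or_ge (T.ε + T.ε ^ 2 / 4) (T.D.f w) with h | h
  · rwa [T.lev_eq_f_of_lt h]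
  · rw [lev_eq]
    have h1 := Profile.theta_le T.ε_pos (T.sCoord_nonneg w)
    have h2 := T.two_mul_bound_lt
    unfold sCoord at h1
    linarith

/-- `ℓ(w) ∈ [0, a]` when `g w < a`. [folklore] -/
theorem lev_mem_Icc {w : W} (hw : T.D.f w < T.Γ.a) : T.lev w ∈ Icc 0 T.Γ.a :=
  ⟨(T.lev_pos w).le, (T.lev_lt_a hw).le⟩

open Classical in
/-- **The push map** `R(w) = Fl (ret w) (ℓ w)`: flow out from the boundary point below `w` up to
the level `ℓ(w) = g w + θ_ε(μ_ε(g w))` (the identity deep inside, where `ℓ w = g w`). [folklore] -/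
def push (w : W) : W := if T.D.f w < T.Γ.a then T.Γ.Fl (T.Γ.ret w) (T.lev w) else w

/-- Unfolding the push near the boundary (`g w < a`). [folklore] -/
theorem push_of_lt {w : W} (hw : T.D.f w < T.Γ.a) : T.push w = T.Γ.Fl (T.Γ.ret w) (T.lev w) := by
  unfold push; rw [if_pos hw]

/-- Unfolding the push deep inside (`a ≤ g w`): the identity. [folklore] -/
theorem push_of_le {w : W} (hw : T.Γ.a ≤ T.D.f w) : T.push w = w := by
  unfold push; rw [if_neg (not_lt.2 hw)]

/-- **The level of the push**: `g (R w) = ℓ(w)`. [folklore] -/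
theorem f_push (w : W) : T.D.f (T.push w) = T.lev w := by
  rcases lt_or_ge (T.D.f w) T.Γ.a with h | h
  · rw [T.push_of_lt h, T.Γ.f_Fl_ret h.le (T.lev_mem_Icc h)]
  · rw [T.push_of_le h, T.lev_eq_f_of_lt (lt_of_lt_of_le T.bound_lt h)]

/-- The push lands in the interior of `W` (its level is `≥ ε > 0`). [folklore] -/
theorem push_mem_interior (w : W) : T.push w ∈ (𝓡∂ (n + 1)).interior W := by
  rw [← ModelWithCorners.compl_boundary, mem_compl_iff, ← T.D.f_eq_zero_iff, f_push]
  exact (T.lev_pos w).ne'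

/-- The push lands in the interior of `W` (pointwise form). [folklore] -/
theorem isInteriorPoint_push (w : W) : (𝓡∂ (n + 1)).IsInteriorPoint (T.push w) :=
  T.push_mem_interior w

/-- `g (R w) < a` when `g w < a`. [folklore] -/
theorem f_push_lt_a {w : W} (hw : T.D.f w < T.Γ.a) : T.D.f (T.push w) < T.Γ.a := by
  rw [f_push]; exact T.lev_lt_a hw

/-- The coordinate `S` is `C^∞`. [folklore] -/
theorem contMDiff_sCoord : ContMDiff (𝓡∂ (n + 1)) 𝓘(ℝ, ℝ) ∞ T.sCoord :=
  (Profile.contDiff_mu T.ε_pos).contMDiff.comp T.D.f_smooth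

/-- The target level `ℓ` is `C^∞`. [folklore] -/
theorem contMDiff_lev : ContMDiff (𝓡∂ (n + 1)) 𝓘(ℝ, ℝ) ∞ T.lev :=
  contMDiff_const.add (T.contMDiff_sCoord.pow 2)

open Classical in
/-- The homotopy `H(t, w) = Fl (ret w) ((1 - t) g w + t ℓ w)` from `id` (`t = 0`) to the push
(`t = 1`), the identity deep inside. [folklore] -/
def pushHomotopyFun (p : ℝ × W) : W :=
  if T.D.f p.2 < T.Γ.a then T.Γ.Fl (T.Γ.ret p.2) ((1 - p.1) * T.D.f p.2 + p.1 * T.lev p.2) else p.2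

/-- Unfolding the homotopy near the boundary (`g w < a`). [folklore] -/
theorem pushHomotopyFun_of_lt {t : ℝ} {w : W} (hw : T.D.f w < T.Γ.a) :
    T.pushHomotopyFun (t, w) = T.Γ.Fl (T.Γ.ret w) ((1 - t) * T.D.f w + t * T.lev w) := by
  unfold pushHomotopyFun; exact if_pos hw

/-- Unfolding the homotopy deep inside (`a ≤ g w`): stationary. [folklore] -/
theorem pushHomotopyFun_of_le {t : ℝ} {w : W} (hw : T.Γ.a ≤ T.D.f w) : T.pushHomotopyFun (t, w) = w := by
  unfold pushHomotopyFun; exact if_neg (not_lt.2 hw)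

/-- The level `(1 - t) g w + t ℓ(w)` of the homotopy lies in `[0, a]`. [folklore] -/
theorem homotopyLevel_mem {t : ℝ} (ht : t ∈ Icc (0 : ℝ) 1) {w : W} (hw : T.D.f w < T.Γ.a) :
    (1 - t) * T.D.f w + t * T.lev w ∈ Icc 0 T.Γ.a := by
  have h1 := T.D.f_nonneg w
  have h2 := T.f_le_lev w
  have h3 := T.lev_lt_a hw
  constructor <;> nlinarith [ht.1, ht.2]

/-- At `t = 1` the homotopy is the push. [folklore] -/
theorem pushHomotopyFun_one (w : W) : T.pushHomotopyFun (1, w) = T.push w := by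
  rcases lt_or_ge (T.D.f w) T.Γ.a with h | h
  · rw [T.pushHomotopyFun_of_lt h, T.push_of_lt h]; simp
  · rw [T.pushHomotopyFun_of_le h, T.push_of_le h]

/-- **The level along the homotopy**: `g (H(t, w)) = (1 - t) g w + t ℓ w` for `t ∈ [0, 1]`.
[folklore] -/
theorem f_pushHomotopyFun {t : ℝ} (ht : t ∈ Icc (0 : ℝ) 1) (w : W) :
    T.D.f (T.pushHomotopyFun (t, w)) = (1 - t) * T.D.f w + t * T.lev w := by
  rcases lt_or_ge (T.D.f w) T.Γ.a with h | h
  · rw [T.pushHomotopyFun_of_lt h]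
    exact T.Γ.f_Fl_ret h.le (T.homotopyLevel_mem ht h)
  · rw [T.pushHomotopyFun_of_le h, T.lev_eq_f_of_lt (lt_of_lt_of_le T.bound_lt h)]; ring

/-- Along the homotopy the level does not decrease: `g w ≤ g (H(t, w))`. [folklore] -/
theorem f_le_f_pushHomotopyFun {t : ℝ} (ht : t ∈ Icc (0 : ℝ) 1) (w : W) :
    T.D.f w ≤ T.D.f (T.pushHomotopyFun (t, w)) := by
  rw [T.f_pushHomotopyFun ht]
  have := T.f_le_lev w
  nlinarith [ht.1, ht.2]

variable [T2Space W]

/-- Deep inside (`g w > ε + ε²/4`) the push is the identity. [folklore] -/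
theorem push_eq_self_of_lt {w : W} (hw : T.ε + T.ε ^ 2 / 4 < T.D.f w) : T.push w = w := by
  rcases lt_or_ge (T.D.f w) T.Γ.a with h | h
  · rw [T.push_of_lt h, T.lev_eq_f_of_lt hw]
    exact T.Γ.Fl_ret h.le
  · exact T.push_of_le h

/-- The retraction of the push is the retraction: `ret (R w) = ret w` (`g w < a`). [folklore] -/
theorem ret_push {w : W} (hw : T.D.f w < T.Γ.a) : T.Γ.ret (T.push w) = T.Γ.ret w := by
  rw [T.push_of_lt hw]
  exact T.Γ.ret_Fl_ret hw.le (T.lev_mem_Icc hw)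

/-- **The push map is `C^∞`**: on `{g < a}` it is the flow-out of `(ret w, ℓ w)` (jointly smooth
in both), on `{g > ε + ε²/4}` it is the identity, and these open sets cover `W`. [folklore] -/
theorem contMDiff_push : ContMDiff (𝓡∂ (n + 1)) (𝓡∂ (n + 1)) ∞ T.push := by
  intro w₀
  rcases lt_or_ge (T.ε + T.ε ^ 2 / 4) (T.D.f w₀) with h | h
  · -- identity near `w₀`
    have hopen : IsOpen {w : W | T.ε + T.ε ^ 2 / 4 < T.D.f w} :=
      isOpen_lt continuous_const T.D.f_smooth.continuous
    refine contMDiffAt_id.congr_of_eventuallyEq ?_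
    filter_upwards [hopen.mem_nhds h] with w hw using T.push_eq_self_of_lt hw
  · have hlt : T.D.f w₀ < T.Γ.a := lt_of_le_of_lt h T.bound_lt
    have hopen : IsOpen {w : W | T.D.f w < T.Γ.a} := isOpen_lt T.D.f_smooth.continuous continuous_const
    have h1 : ContMDiffOn (𝓡∂ (n + 1)) ((𝓡∂ (n + 1)).prod 𝓘(ℝ, ℝ)) ∞
        (fun w => (T.Γ.ret w, T.lev w)) {w | T.D.f w < T.Γ.a} :=
      T.Γ.contMDiffOn_ret_lt.prodMk T.contMDiff_lev.contMDiffOn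
    have hmaps : MapsTo (fun w => (T.Γ.ret w, T.lev w)) {w | T.D.f w < T.Γ.a}
        ({z | T.D.f z < T.Γ.a} ×ˢ Icc 0 T.Γ.a) :=
      fun w hw => ⟨by
        show T.D.f (T.Γ.ret w) < T.Γ.a
        rw [T.Γ.f_ret (le_of_lt hw)]; exact T.Γ.a_pos, T.lev_mem_Icc hw⟩
    have hon : ContMDiffOn (𝓡∂ (n + 1)) (𝓡∂ (n + 1)) ∞
        ((fun p : W × ℝ => T.Γ.Fl p.1 p.2) ∘ fun w => (T.Γ.ret w, T.lev w)) {w | T.D.f w < T.Γ.a} :=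
      T.Γ.contMDiffOn_Fl.comp h1 hmaps
    refine (hon.contMDiffAt (hopen.mem_nhds hlt)).congr_of_eventuallyEq ?_
    filter_upwards [hopen.mem_nhds hlt] with w hw using T.push_of_lt hw

/-- The push is continuous. [folklore] -/
theorem continuous_push : Continuous T.push := T.contMDiff_push.continuous

/-- At `t = 0` the homotopy is the identity. [folklore] -/
theorem pushHomotopyFun_zero (w : W) : T.pushHomotopyFun (0, w) = w := by
  rcases lt_or_ge (T.D.f w) T.Γ.a with h | h
  · rw [T.pushHomotopyFun_of_lt h]
    simp only [sub_zero, one_mul, zero_mul, add_zero]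
    exact T.Γ.Fl_ret h.le
  · exact T.pushHomotopyFun_of_le h

/-- Deep inside, the homotopy is stationary. [folklore] -/
theorem pushHomotopyFun_eq_self_of_lt (t : ℝ) {w : W} (hw : T.ε + T.ε ^ 2 / 4 < T.D.f w) :
    T.pushHomotopyFun (t, w) = w := by
  rcases lt_or_ge (T.D.f w) T.Γ.a with h | h
  · rw [T.pushHomotopyFun_of_lt h, T.lev_eq_f_of_lt hw,
      show (1 - t) * T.D.f w + t * T.D.f w = T.D.f w by ring]
    exact T.Γ.Fl_ret h.le
  · exact T.pushHomotopyFun_of_le h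

/-- **The homotopy is continuous** on `[0, 1] × W`. [folklore] -/
theorem continuousOn_pushHomotopyFun :
    ContinuousOn T.pushHomotopyFun (Icc (0 : ℝ) 1 ×ˢ univ) := by
  rintro ⟨t₀, w₀⟩ ⟨ht₀, -⟩
  rcases lt_or_ge (T.ε + T.ε ^ 2 / 4) (T.D.f w₀) with h | h
  · -- identity near `w₀`, for all `t`
    have hopen : IsOpen {p : ℝ × W | T.ε + T.ε ^ 2 / 4 < T.D.f p.2} :=
      isOpen_lt continuous_const (T.D.f_smooth.continuous.comp continuous_snd)
    have hev : T.pushHomotopyFun =ᶠ[𝓝[Icc (0 : ℝ) 1 ×ˢ univ] (t₀, w₀)] fun p => p.2 := by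
      refine Filter.eventually_of_mem (mem_nhdsWithin_of_mem_nhds (hopen.mem_nhds h)) ?_
      rintro ⟨t, w⟩ hw
      exact T.pushHomotopyFun_eq_self_of_lt t hw
    exact (continuous_snd.continuousWithinAt).congr_of_eventuallyEq hev
      (T.pushHomotopyFun_eq_self_of_lt t₀ h)
  · have hlt : T.D.f w₀ < T.Γ.a := lt_of_le_of_lt h T.bound_lt
    have hopen : IsOpen {p : ℝ × W | T.D.f p.2 < T.Γ.a} :=
      isOpen_lt (T.D.f_smooth.continuous.comp continuous_snd) continuous_const
    set lv : ℝ × W → ℝ := fun p => (1 - p.1) * T.D.f p.2 + p.1 * T.lev p.2 with hlv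
    have hlvc : Continuous lv :=
      ((continuous_const.sub continuous_fst).mul (T.D.f_smooth.continuous.comp continuous_snd)).add
        (continuous_fst.mul (T.contMDiff_lev.continuous.comp continuous_snd))
    set S : Set (ℝ × W) := (Icc (0 : ℝ) 1 ×ˢ univ) ∩ {p : ℝ × W | T.D.f p.2 < T.Γ.a} with hS
    have h1 : ContinuousOn (fun p : ℝ × W => (T.Γ.ret p.2, lv p)) S :=
      (T.Γ.contMDiffOn_ret_lt.continuousOn.comp continuous_snd.continuousOn fun p hp => hp.2).prodMk
        hlvc.continuousOn
    have hmaps : MapsTo (fun p : ℝ × W => (T.Γ.ret p.2, lv p)) S ({z | T.D.f z ≤ T.Γ.a} ×ˢ Icc 0 T.Γ.a) := by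
      rintro ⟨t, w⟩ ⟨⟨ht, -⟩, hw⟩
      refine ⟨?_, T.homotopyLevel_mem ht hw⟩
      show T.D.f (T.Γ.ret w) ≤ T.Γ.a
      rw [T.Γ.f_ret (le_of_lt hw)]; exact T.Γ.a_pos.le
    have hon : ContinuousOn ((fun p : W × ℝ => T.Γ.Fl p.1 p.2) ∘ fun p : ℝ × W => (T.Γ.ret p.2, lv p)) S :=
      T.Γ.continuousOn_Fl.comp h1 hmaps
    have hS_mem : S ∈ 𝓝[Icc (0 : ℝ) 1 ×ˢ univ] (t₀, w₀) :=
      inter_mem self_mem_nhdsWithin (mem_nhdsWithin_of_mem_nhds (hopen.mem_nhds hlt))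
    have h2 : ContinuousWithinAt
        ((fun p : W × ℝ => T.Γ.Fl p.1 p.2) ∘ fun p : ℝ × W => (T.Γ.ret p.2, lv p))
        (Icc (0 : ℝ) 1 ×ˢ univ) (t₀, w₀) :=
      (hon.continuousWithinAt ⟨⟨ht₀, mem_univ _⟩, hlt⟩).mono_of_mem_nhdsWithin hS_mem
    have hev : T.pushHomotopyFun =ᶠ[𝓝[Icc (0 : ℝ) 1 ×ˢ univ] (t₀, w₀)]
        ((fun p : W × ℝ => T.Γ.Fl p.1 p.2) ∘ fun p : ℝ × W => (T.Γ.ret p.2, lv p)) := by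
      refine Filter.eventually_of_mem (mem_nhdsWithin_of_mem_nhds (hopen.mem_nhds hlt)) ?_
      rintro ⟨t, w⟩ hw
      exact T.pushHomotopyFun_of_lt hw
    exact h2.congr_of_eventuallyEq hev (T.pushHomotopyFun_of_lt hlt)

end Push

end PushData

/-! ### Sheet data: an adapted-type Morse function with push data for `g = 1 - f` -/

/-- **Sheet data**: push data (`D`, `Γ`, `ε`) whose boundary-defining function is `g = 1 - f` for
a Morse function `f` (so `f = 1` exactly on `∂W`, `f < 1` inside) all of whose critical values
lie below `1 - ε`. [folklore] -/
structure SheetData (n : ℕ) (W : Type u) [TopologicalSpace W]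
    [ChartedSpace (EuclideanHalfSpace (n + 1)) W] [IsManifold (𝓡∂ (n + 1)) ∞ W]
    extends PushData n W where
  /-- The Morse function. -/
  f : W → ℝ
  /-- `f` is a Morse function. -/
  isMorse : IsMorse (𝓡∂ (n + 1)) f
  /-- The boundary-defining function of the flow-out is `g = 1 - f`. -/
  f_eq : ∀ z, D.f z = 1 - f z
  /-- All critical values of `f` lie below `1 - ε`. -/
  lt_of_isMCriticalPt : ∀ w, IsMCriticalPt (𝓡∂ (n + 1)) f w → f w < 1 - ε

namespace SheetData

section Basic

variable {n : ℕ} {W : Type u} [TopologicalSpace W]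
  [ChartedSpace (EuclideanHalfSpace (n + 1)) W] [IsManifold (𝓡∂ (n + 1)) ∞ W]
  (S : SheetData n W)

/-- `1 - ε` is not a critical value of `f`. [folklore] -/
theorem ne_of_isMCriticalPt (w : W) (hw : IsMCriticalPt (𝓡∂ (n + 1)) S.f w) : S.f w ≠ 1 - S.ε :=
  (S.lt_of_isMCriticalPt w hw).ne

/-- `g = 1 - f`. [folklore] -/
theorem g_eq (z : W) : S.D.f z = 1 - S.f z := S.f_eq z

/-- `f = 1 - g`. [folklore] -/
theorem f_eq' (z : W) : S.f z = 1 - S.D.f z := by rw [S.f_eq z]; ring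

/-- The recharting isomorphism `ℝⁿ⁺¹ × ℝ ≅ ℝⁿ⁺²` used for the ambient. [folklore] -/
abbrev L (n : ℕ) : (𝔼 (n + 1) × ℝ) ≃L[ℝ] 𝔼 (n + 1 + 1) := BoundaryManifold.consCLE (n + 1)

/-- **The thickening** `V = {(w, s) : f w + s² ≤ 1 - ε}` of the sheet data. [folklore] -/
abbrev V : Type u := Thickening (L n) S.isMorse S.ne_of_isMCriticalPt

/-- **The boundary** `C = ∂V = {f w + s² = 1 - ε}` (a boundaryless `(n+1)`-manifold). [folklore] -/
abbrev C : Type u := ↥((𝓡∂ (n + 1 + 1)).boundary S.V)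

omit [IsManifold (𝓡∂ (n + 1)) ∞ W] in
/-- Interior points of `W` give interior points of `W × ℝ`. [folklore] -/
theorem isInteriorPoint_prod {p : W × ℝ} (hp : (𝓡∂ (n + 1)).IsInteriorPoint p.1) :
    (prodModel n).IsInteriorPoint p := by
  show p ∈ (prodModel n).interior (W × ℝ)
  rw [ModelWithCorners.interior_prod, ModelWithCorners.interior_eq_univ (I := 𝓘(ℝ, ℝ))]
  exact ⟨hp, mem_univ _⟩

/-- The point of the ambient over `p = (w, s)` with `w` interior. [folklore] -/
def ambOf (p : W × ℝ) (hp : (𝓡∂ (n + 1)).IsInteriorPoint p.1) : Ambient W (L n) :=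
  Recharted.of (L n) ⟨p, isInteriorPoint_prod hp⟩

omit [IsManifold (𝓡∂ (n + 1)) ∞ W] in
/-- The underlying point of `ambOf p` is `p` (definitional). [folklore] -/
@[simp] theorem pt_ambOf (p : W × ℝ) (hp : (𝓡∂ (n + 1)).IsInteriorPoint p.1) :
    pt (L n) (ambOf p hp) = p := rfl

/-- The point of `V` over `p = (w, s)` with `w` interior and `f w + s² ≤ 1 - ε`. [folklore] -/
def vOf (p : W × ℝ) (hp : (𝓡∂ (n + 1)).IsInteriorPoint p.1) (hle : S.f p.1 + p.2 ^ 2 ≤ 1 - S.ε) : S.V :=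
  RegularSublevel.mk _ (ambOf p hp) hle

/-- The underlying point of `W × ℝ` of a point of `V`. [folklore] -/
def baseV (x : S.V) : W × ℝ := Thickening.base (L n) S.isMorse S.ne_of_isMCriticalPt x

/-- The underlying point of `vOf p` is `p` (definitional). [folklore] -/
@[simp] theorem baseV_vOf (p : W × ℝ) (hp : (𝓡∂ (n + 1)).IsInteriorPoint p.1)
    (hle : S.f p.1 + p.2 ^ 2 ≤ 1 - S.ε) : S.baseV (S.vOf p hp hle) = p := rfl

/-- Points of `V` satisfy `f w + s² ≤ 1 - ε`. [folklore] -/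
theorem f_baseV_le (x : S.V) : S.f (S.baseV x).1 + (S.baseV x).2 ^ 2 ≤ 1 - S.ε :=
  Thickening.apply_base_le _ _ _ x

/-- `baseV : V → W × ℝ` is injective. [folklore] -/
theorem injective_baseV : Injective S.baseV := Thickening.injective_base _ _ _

/-- Base points of points of `V` are interior points of `W`. [folklore] -/
theorem isInteriorPoint_baseV (x : S.V) : (𝓡∂ (n + 1)).IsInteriorPoint (S.baseV x).1 :=
  isInteriorPoint_fst_pt _ _

/-- `∂V = {f w + s² = 1 - ε}`. [folklore] -/
theorem mem_boundary_iff (x : S.V) :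
    x ∈ (𝓡∂ (n + 1 + 1)).boundary S.V ↔ S.f (S.baseV x).1 + (S.baseV x).2 ^ 2 = 1 - S.ε :=
  RegularSublevel.mem_boundary_iff _ x

/-- The point of `C = ∂V` over `p = (w, s)` with `w` interior and `f w + s² = 1 - ε`. [folklore] -/
def cOf (p : W × ℝ) (hp : (𝓡∂ (n + 1)).IsInteriorPoint p.1) (heq : S.f p.1 + p.2 ^ 2 = 1 - S.ε) : S.C :=
  ⟨S.vOf p hp heq.le, (S.mem_boundary_iff _).2 heq⟩

/-- The underlying point of `W × ℝ` of a point of `C`. [folklore] -/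
def baseC (z : S.C) : W × ℝ := S.baseV z.1

/-- The underlying point of `cOf p` is `p` (definitional). [folklore] -/
@[simp] theorem baseC_cOf (p : W × ℝ) (hp : (𝓡∂ (n + 1)).IsInteriorPoint p.1)
    (heq : S.f p.1 + p.2 ^ 2 = 1 - S.ε) : S.baseC (S.cOf p hp heq) = p := rfl

/-- Points of `C` satisfy `f w + s² = 1 - ε`. [folklore] -/
theorem f_baseC (z : S.C) : S.f (S.baseC z).1 + (S.baseC z).2 ^ 2 = 1 - S.ε :=
  (S.mem_boundary_iff z.1).1 z.2

/-- On `C`, `g w = ε + s²`. [folklore] -/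
theorem g_baseC (z : S.C) : S.D.f (S.baseC z).1 = S.ε + (S.baseC z).2 ^ 2 := by
  rw [S.g_eq]; linarith [S.f_baseC z]

/-- `baseC : C → W × ℝ` is injective. [folklore] -/
theorem injective_baseC : Injective S.baseC := fun _ _ h =>
  Subtype.ext (S.injective_baseV h)

/-- Base points of points of `C` are interior points of `W`. [folklore] -/
theorem isInteriorPoint_baseC (z : S.C) : (𝓡∂ (n + 1)).IsInteriorPoint (S.baseC z).1 :=
  S.isInteriorPoint_baseV z.1

/-- `cOf ∘ baseC = id`. [folklore] -/
theorem cOf_baseC (z : S.C) : S.cOf (S.baseC z) (S.isInteriorPoint_baseC z) (S.f_baseC z) = z :=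
  S.injective_baseC rfl

/-- The base projection `q : C → W`. [folklore] -/
def qC (z : S.C) : W := (S.baseC z).1

/-- The signed height `s : C → ℝ`. [folklore] -/
def σC (z : S.C) : ℝ := (S.baseC z).2

/-- On `C`, `g q = ε + s²`. [folklore] -/
theorem g_qC (z : S.C) : S.D.f (S.qC z) = S.ε + S.σC z ^ 2 := S.g_baseC z

/-- On `C`, `g q ≥ ε`. [folklore] -/
theorem ε_le_g_qC (z : S.C) : S.ε ≤ S.D.f (S.qC z) := by rw [S.g_qC]; nlinarith

/-- `baseV : V → W × ℝ` is `C^∞`. [folklore] -/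
theorem contMDiff_baseV : ContMDiff (𝓡∂ (n + 1 + 1)) (prodModel n) ∞ S.baseV :=
  (contMDiff_pt (L n)).comp (RegularSublevel.contMDiff_incl _)

/-- `baseC : C → W × ℝ` is `C^∞`. [folklore] -/
theorem contMDiff_baseC : ContMDiff (𝓡 (n + 1)) (prodModel n) ∞ S.baseC :=
  S.contMDiff_baseV.comp
    (BoundaryManifold.isSmoothEmbedding_subtype_val (n := n + 1) (W := S.V)).contMDiff

/-- The base projection `q : C → W` is `C^∞`. [folklore] -/
theorem contMDiff_qC : ContMDiff (𝓡 (n + 1)) (𝓡∂ (n + 1)) ∞ S.qC :=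
  contMDiff_fst.comp S.contMDiff_baseC

/-- The height `s : C → ℝ` is `C^∞`. [folklore] -/
theorem contMDiff_σC : ContMDiff (𝓡 (n + 1)) 𝓘(ℝ, ℝ) ∞ S.σC :=
  contMDiff_snd.comp S.contMDiff_baseC

/-- `baseC` is continuous. [folklore] -/
theorem continuous_baseC : Continuous S.baseC := S.contMDiff_baseC.continuous

/-- **Smooth maps into `V`**: a map `x ↦ (p x)` into `W × ℝ` which is `C^∞` (for the product
corners model), with interior base points and `f + s² ≤ 1 - ε`, is `C^∞` into `V`. [folklore] -/
theorem contMDiff_vOf {X : Type*} [TopologicalSpace X] {HX : Type*} [TopologicalSpace HX]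
    {EX : Type*} [NormedAddCommGroup EX] [NormedSpace ℝ EX] {J : ModelWithCorners ℝ EX HX}
    [ChartedSpace HX X] {p : X → W × ℝ} (hp : ContMDiff J (prodModel n) ∞ p)
    (hint : ∀ x, (𝓡∂ (n + 1)).IsInteriorPoint (p x).1) (hle : ∀ x, S.f (p x).1 + (p x).2 ^ 2 ≤ 1 - S.ε) :
    ContMDiff J (𝓡∂ (n + 1 + 1)) ∞ fun x => S.vOf (p x) (hint x) (hle x) := by
  have h1 : ContMDiff J 𝓘(ℝ, 𝔼 (n + 1) × ℝ) ∞
      fun x => (⟨p x, isInteriorPoint_prod (hint x)⟩ : InteriorManifold (prodModel n) (W × ℝ)) :=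
    InteriorManifold.contMDiff_iff_comp_val.2 hp
  have h2 : ContMDiff J (𝓡 (n + 1 + 1)) ∞ fun x => ambOf (p x) (hint x) :=
    (Recharted.contMDiff_of (L n)).comp h1
  exact (RegularSublevel.halfSliceAtlas
    (isRegularLevel_thickFun (L n) S.isMorse S.ne_of_isMCriticalPt)).contMDiff_codRestrict
    (fun x => hle x) h2

/-- **Smooth maps into `C = ∂V`**. [folklore] -/
theorem contMDiff_cOf {X : Type*} [TopologicalSpace X] {HX : Type*} [TopologicalSpace HX]
    {EX : Type*} [NormedAddCommGroup EX] [NormedSpace ℝ EX] {J : ModelWithCorners ℝ EX HX}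
    [ChartedSpace HX X] {p : X → W × ℝ} (hp : ContMDiff J (prodModel n) ∞ p)
    (hint : ∀ x, (𝓡∂ (n + 1)).IsInteriorPoint (p x).1) (heq : ∀ x, S.f (p x).1 + (p x).2 ^ 2 = 1 - S.ε) :
    ContMDiff J (𝓡 (n + 1)) ∞ fun x => S.cOf (p x) (hint x) (heq x) :=
  BoundaryManifold.contMDiff_codRestrict
    (fun x => (S.mem_boundary_iff (S.vOf (p x) (hint x) (heq x).le)).2 (heq x))
    (S.contMDiff_vOf hp hint fun x => (heq x).le)

end Basic

/-! ### The two sheets `j_σ : W → C`, `σ = ±1` -/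

section Sheets

variable {n : ℕ} {W : Type u} [TopologicalSpace W]
  [ChartedSpace (EuclideanHalfSpace (n + 1)) W] [IsManifold (𝓡∂ (n + 1)) ∞ W]
  (S : SheetData n W)

/-- `f (R w) = 1 - ℓ(w)`. [folklore] -/
theorem f_push (w : W) : S.f (S.push w) = 1 - S.lev w := by
  rw [S.f_eq', S.toPushData.f_push]

/-- The level identity of the sheets: `f (R w) + (σ S w)² = 1 - ε` for `σ² = 1`. [folklore] -/
theorem thick_sheet {σ : ℝ} (hσ : σ * σ = 1) (w : W) :
    S.f (S.push w) + (σ * S.sCoord w) ^ 2 = 1 - S.ε := by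
  rw [S.f_push, PushData.lev, mul_pow, show σ ^ 2 = 1 by rw [sq, hσ], one_mul]; ring

/-- **The sheet** `j_σ(w) = (R w, σ S w) ∈ C` (`σ = 1`: upper sheet, `σ = -1`: lower sheet).
[folklore] -/
def sheet {σ : ℝ} (hσ : σ * σ = 1) (w : W) : S.C :=
  S.cOf (S.push w, σ * S.sCoord w) (S.isInteriorPoint_push w) (S.thick_sheet hσ w)

variable {σ : ℝ} (hσ : σ * σ = 1)

/-- The underlying point of `j_σ(w)` is `(R w, σ S w)` (definitional). [folklore] -/
@[simp] theorem baseC_sheet (w : W) : S.baseC (S.sheet hσ w) = (S.push w, σ * S.sCoord w) := rfl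

/-- `q (j_σ w) = R w` (definitional). [folklore] -/
@[simp] theorem qC_sheet (w : W) : S.qC (S.sheet hσ w) = S.push w := rfl

/-- `s (j_σ w) = σ S w` (definitional). [folklore] -/
@[simp] theorem σC_sheet (w : W) : S.σC (S.sheet hσ w) = σ * S.sCoord w := rfl

variable [T2Space W]

/-- The sheets are `C^∞`. [folklore] -/
theorem contMDiff_sheet : ContMDiff (𝓡∂ (n + 1)) (𝓡 (n + 1)) ∞ (S.sheet hσ) :=
  S.contMDiff_cOf (S.contMDiff_push.prodMk (contMDiff_const.mul S.contMDiff_sCoord))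
    (fun w => S.isInteriorPoint_push w) fun w => S.thick_sheet hσ w

/-- The sheets are continuous. [folklore] -/
theorem continuous_sheet : Continuous (S.sheet hσ) := (S.contMDiff_sheet hσ).continuous

end Sheets

end SheetData

namespace Profile

variable {ε : ℝ}

/-- `ν_ε(u) ≥ 0` for `u ≥ 0`. [folklore] -/
theorem nu_nonneg (hε : 0 < ε) {u : ℝ} (hu : 0 ≤ u) : 0 ≤ nu ε u := by
  rw [← nu_zero hε]; exact (strictMono_nu hε).monotone hu

/-- `ν_ε(u) ≤ ε + u²`. [folklore] -/
theorem nu_le_sq (hε : 0 < ε) (u : ℝ) : nu ε u ≤ ε + u ^ 2 := by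
  linarith [nu_add_theta (ε := ε) u, theta_nonneg hε u]

/-- `ν_ε(u) = ε + u²` for `u ≥ 0` with `ε + u² > ε + ε²/4`. [folklore] -/
theorem nu_eq_sq_of_bound_lt (hε : 0 < ε) {u : ℝ} (hu : 0 ≤ u) (h : ε + ε ^ 2 / 4 < ε + u ^ 2) :
    nu ε u = ε + u ^ 2 := by
  apply nu_eq_sq hε
  nlinarith

end Profile

namespace SheetData

/-! ### The flow-back `Ψ_σ : C → W` (inverse of the sheet `j_σ` on `{σ s ≥ 0}`) -/

section FlowBack

variable {n : ℕ} {W : Type u} [TopologicalSpace W]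
  [ChartedSpace (EuclideanHalfSpace (n + 1)) W] [IsManifold (𝓡∂ (n + 1)) ∞ W]
  (S : SheetData n W) {σ : ℝ} (hσ : σ * σ = 1)

include hσ in
/-- `σ ≠ 0` when `σ² = 1`. [folklore] -/
theorem σ_ne_zero : σ ≠ 0 := by
  rintro rfl; norm_num at hσ

include hσ in
/-- On `C`, `g q = ε + (σ s)²`. [folklore] -/
theorem g_qC_eq (z : S.C) : S.D.f (S.qC z) = S.ε + (σ * S.σC z) ^ 2 := by
  rw [S.g_qC, mul_pow, show σ ^ 2 = 1 by rw [sq, hσ], one_mul]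

open Classical in
/-- **The flow-back** `Ψ_σ(q, s) = Fl (ret q) (ν_ε(σ s))` (near the boundary), `= q` (deep
inside): the point of `W` on the flow line of `q` at level `ν_ε(σ s)`. [folklore] -/
def Ψ (σ : ℝ) (z : S.C) : W :=
  if S.D.f (S.qC z) < S.Γ.a then S.Γ.Fl (S.Γ.ret (S.qC z)) (Profile.nu S.ε (σ * S.σC z)) else S.qC z

/-- Unfolding the flow-back near the boundary (`g q < a`). [folklore] -/
theorem Ψ_of_lt {z : S.C} (h : S.D.f (S.qC z) < S.Γ.a) :
    S.Ψ σ z = S.Γ.Fl (S.Γ.ret (S.qC z)) (Profile.nu S.ε (σ * S.σC z)) := by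
  unfold Ψ; rw [if_pos h]

/-- Unfolding the flow-back deep inside (`a ≤ g q`): the base projection. [folklore] -/
theorem Ψ_of_le {z : S.C} (h : S.Γ.a ≤ S.D.f (S.qC z)) : S.Ψ σ z = S.qC z := by
  unfold Ψ; rw [if_neg (not_lt.2 h)]

include hσ in
/-- The flow-back time `ν_ε(σ s)` lies in `[0, a]` on `{σ s ≥ 0, g q < a}`. [folklore] -/
theorem nu_mem_Icc {z : S.C} (hu : 0 ≤ σ * S.σC z) (hlt : S.D.f (S.qC z) < S.Γ.a) :
    Profile.nu S.ε (σ * S.σC z) ∈ Icc 0 S.Γ.a := by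
  refine ⟨Profile.nu_nonneg S.ε_pos hu, ?_⟩
  have := Profile.nu_le_sq S.ε_pos (σ * S.σC z)
  rw [← S.g_qC_eq hσ] at this
  linarith

include hσ in
/-- Deep inside (`g q > ε + ε²/4`), `ν_ε(σ s) = g q` on `{σ s ≥ 0}`. [folklore] -/
theorem nu_eq_g {z : S.C} (hu : 0 ≤ σ * S.σC z) (h : S.ε + S.ε ^ 2 / 4 < S.D.f (S.qC z)) :
    Profile.nu S.ε (σ * S.σC z) = S.D.f (S.qC z) := by
  rw [S.g_qC_eq hσ] at h ⊢
  exact Profile.nu_eq_sq_of_bound_lt S.ε_pos hu h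

include hσ in
/-- The level of the flow-back: `g (Ψ_σ z) = ν_ε(σ s)`. [folklore] -/
theorem g_Ψ {z : S.C} (hu : 0 ≤ σ * S.σC z) : S.D.f (S.Ψ σ z) = Profile.nu S.ε (σ * S.σC z) := by
  rcases lt_or_ge (S.D.f (S.qC z)) S.Γ.a with hlt | hle
  · rw [S.Ψ_of_lt hlt]
    exact S.Γ.f_Fl_ret hlt.le (S.nu_mem_Icc hσ hu hlt)
  · rw [S.Ψ_of_le hle, S.nu_eq_g hσ hu (lt_of_lt_of_le S.bound_lt hle)]

include hσ in
/-- `S (Ψ_σ z) = σ s`. [folklore] -/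
theorem sCoord_Ψ {z : S.C} (hu : 0 ≤ σ * S.σC z) : S.sCoord (S.Ψ σ z) = σ * S.σC z := by
  rw [PushData.sCoord, S.g_Ψ hσ hu, Profile.mu_nu]

variable [T2Space W]

include hσ in
/-- Deep inside, the flow-back is the base projection. [folklore] -/
theorem Ψ_eq_qC {z : S.C} (hu : 0 ≤ σ * S.σC z) (h : S.ε + S.ε ^ 2 / 4 < S.D.f (S.qC z)) :
    S.Ψ σ z = S.qC z := by
  rcases lt_or_ge (S.D.f (S.qC z)) S.Γ.a with hlt | hle
  · rw [S.Ψ_of_lt hlt, S.nu_eq_g hσ hu h]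
    exact S.Γ.Fl_ret hlt.le
  · exact S.Ψ_of_le hle

include hσ in
/-- The push of the flow-back is the base point: `R (Ψ_σ z) = q`. [folklore] -/
theorem push_Ψ {z : S.C} (hu : 0 ≤ σ * S.σC z) : S.push (S.Ψ σ z) = S.qC z := by
  rcases lt_or_ge (S.D.f (S.qC z)) S.Γ.a with hlt | hle
  · have hν := S.nu_mem_Icc hσ hu hlt
    have hw : S.D.f (S.Ψ σ z) < S.Γ.a := by
      rw [S.g_Ψ hσ hu]
      have := Profile.nu_le_sq S.ε_pos (σ * S.σC z)
      rw [← S.g_qC_eq hσ] at this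
      linarith
    rw [S.push_of_lt hw]
    have hret : S.Γ.ret (S.Ψ σ z) = S.Γ.ret (S.qC z) := by
      rw [S.Ψ_of_lt hlt]; exact S.Γ.ret_Fl_ret hlt.le hν
    have hlev : S.lev (S.Ψ σ z) = S.D.f (S.qC z) := by
      rw [PushData.lev, S.sCoord_Ψ hσ hu, S.g_qC_eq hσ]
    rw [hret, hlev]
    exact S.Γ.Fl_ret hlt.le
  · rw [S.Ψ_of_le hle]
    exact S.push_of_le hle

include hσ in
/-- **`j_σ ∘ Ψ_σ = id` on `{σ s ≥ 0}`.** [folklore] -/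
theorem sheet_Ψ {z : S.C} (hu : 0 ≤ σ * S.σC z) : S.sheet hσ (S.Ψ σ z) = z := by
  apply S.injective_baseC
  rw [S.baseC_sheet, S.push_Ψ hσ hu, S.sCoord_Ψ hσ hu, ← mul_assoc, hσ, one_mul]
  rfl

/-- **`Ψ_σ ∘ j_σ = id`.** [folklore] -/
theorem Ψ_sheet (w : W) : S.Ψ σ (S.sheet hσ w) = w := by
  have hq : S.qC (S.sheet hσ w) = S.push w := rfl
  have hs : σ * S.σC (S.sheet hσ w) = S.sCoord w := by
    rw [S.σC_sheet, ← mul_assoc, hσ, one_mul]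
  rcases lt_or_ge (S.D.f w) S.Γ.a with hlt | hle
  · have hlt' : S.D.f (S.qC (S.sheet hσ w)) < S.Γ.a := by rw [hq]; exact S.f_push_lt_a hlt
    rw [S.Ψ_of_lt hlt', hs, S.nu_sCoord, hq, S.ret_push hlt]
    exact S.Γ.Fl_ret hlt.le
  · have hpush : S.push w = w := S.push_of_le hle
    have hle' : S.Γ.a ≤ S.D.f (S.qC (S.sheet hσ w)) := by rw [hq, hpush]; exact hle
    rw [S.Ψ_of_le hle', hq, hpush]

include hσ in
/-- The range of the sheet `j_σ` is `{σ s ≥ 0}`. [folklore] -/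
theorem range_sheet : range (S.sheet hσ) = {z | 0 ≤ σ * S.σC z} := by
  ext z
  constructor
  · rintro ⟨w, rfl⟩
    show 0 ≤ σ * S.σC (S.sheet hσ w)
    rw [S.σC_sheet, ← mul_assoc, hσ, one_mul]
    exact S.sCoord_nonneg w
  · intro hz
    exact ⟨S.Ψ σ z, S.sheet_Ψ hσ hz⟩

/-- The sheets are injective. [folklore] -/
theorem injective_sheet : Injective (S.sheet hσ) := fun w w' h => by
  rw [← S.Ψ_sheet hσ w, h, S.Ψ_sheet hσ w']

end FlowBack

/-! ### `s = 0` is a regular level of the height `s : C → ℝ` -/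

section Regular

variable {n : ℕ} {W : Type u} [TopologicalSpace W]
  [ChartedSpace (EuclideanHalfSpace (n + 1)) W] [IsManifold (𝓡∂ (n + 1)) ∞ W]
  (S : SheetData n W)

/-- Near the boundary, the coordinate `S` is the boundary-defining function `g`. [folklore] -/
theorem sCoord_eventuallyEq {w₀ : W} (hw₀ : w₀ ∈ (𝓡∂ (n + 1)).boundary W) :
    S.sCoord =ᶠ[𝓝 w₀] S.D.f := by
  have h0 : S.D.f w₀ = 0 := (S.D.f_eq_zero_iff w₀).2 hw₀
  have hopen : IsOpen {w : W | S.D.f w < S.ε / 4} := isOpen_lt S.D.f_smooth.continuous continuous_const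
  have hmem : w₀ ∈ {w : W | S.D.f w < S.ε / 4} := by
    show S.D.f w₀ < S.ε / 4; rw [h0]; linarith [S.ε_pos]
  filter_upwards [hopen.mem_nhds hmem] with w hw using S.sCoord_eq_f (le_of_lt hw)

/-- `dg ≠ 0` on the boundary (`ξ(g) = 1` there). [folklore] -/
theorem mfderiv_g_ne_zero {w₀ : W} (hw₀ : w₀ ∈ (𝓡∂ (n + 1)).boundary W) :
    mfderiv (𝓡∂ (n + 1)) 𝓘(ℝ, ℝ) S.D.f w₀ ≠ 0 := by
  intro h
  have h0 : S.D.f w₀ = 0 := (S.D.f_eq_zero_iff w₀).2 hw₀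
  have h1 := S.D.mlineDeriv_f_ξ w₀ (by rw [h0]; exact S.D.δ_pos.le)
  rw [mlineDeriv_def, h] at h1
  have h1' : (0 : ℝ) = 1 := h1
  norm_num at h1'

/-- The signed height `τ_σ = -σ s` (so that `{τ_σ ≤ 0} = {σ s ≥ 0}` is the range of `j_σ`).
[folklore] -/
def τ (σ : ℝ) (z : S.C) : ℝ := -σ * S.σC z

/-- Unfolding `τ_σ`. [folklore] -/
theorem τ_apply (σ : ℝ) (z : S.C) : S.τ σ z = -σ * S.σC z := rfl

/-- `τ_σ z ≤ 0 ↔ σ s ≥ 0`. [folklore] -/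
theorem τ_nonpos_iff (σ : ℝ) (z : S.C) : S.τ σ z ≤ 0 ↔ 0 ≤ σ * S.σC z := by
  rw [τ_apply, neg_mul, neg_nonpos]

variable [T2Space W]

/-- **Regularity along the seam by the chain rule**: if `φ : C → ℝ` is `C^∞` and
`φ ∘ j_{σ'} = S` for some sheet `j_{σ'}`, then `dφ_z ≠ 0` at every point `z` of the seam `{s = 0}`
(there `z = j_{σ'}(w₀)` with `w₀ ∈ ∂W`, `S = g` near `w₀`, and `dg_{w₀} ≠ 0`). [folklore] -/
theorem not_isMCriticalPt_of_comp_sheet {φ : S.C → ℝ} (hφ : ContMDiff (𝓡 (n + 1)) 𝓘(ℝ, ℝ) ∞ φ)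
    {σ' : ℝ} (hσ' : σ' * σ' = 1) (hcomp : ∀ w, φ (S.sheet hσ' w) = S.sCoord w)
    {z : S.C} (hz : S.σC z = 0) : ¬ IsMCriticalPt (𝓡 (n + 1)) φ z := by
  intro hcrit
  have hu : 0 ≤ σ' * S.σC z := by rw [hz, mul_zero]
  set w₀ := S.Ψ σ' z with hw₀
  have hzw : S.sheet hσ' w₀ = z := S.sheet_Ψ hσ' hu
  have hsw : S.sCoord w₀ = 0 := by rw [hw₀, S.sCoord_Ψ hσ' hu, hz, mul_zero]
  have hbd : w₀ ∈ (𝓡∂ (n + 1)).boundary W := (S.sCoord_eq_zero_iff w₀).1 hsw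
  have hcomp' : φ ∘ S.sheet hσ' = S.sCoord := funext hcomp
  have hdiff_sheet : MDifferentiableAt (𝓡∂ (n + 1)) (𝓡 (n + 1)) (S.sheet hσ') w₀ :=
    (S.contMDiff_sheet hσ').mdifferentiableAt (by simp)
  have hdiff_φ : MDifferentiableAt (𝓡 (n + 1)) 𝓘(ℝ, ℝ) φ (S.sheet hσ' w₀) :=
    hφ.mdifferentiableAt (by simp)
  have hchain := mfderiv_comp w₀ hdiff_φ hdiff_sheet
  rw [hzw] at hchain
  unfold IsMCriticalPt at hcrit
  rw [hcrit, ContinuousLinearMap.zero_comp, hcomp', (S.sCoord_eventuallyEq hbd).mfderiv_eq] at hchain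
  exact S.mfderiv_g_ne_zero hbd hchain

/-- **`s = 0` is a regular level of the height `s : C → ℝ`.** [folklore] -/
theorem isRegularLevel_σC : IsRegularLevel (𝓡 (n + 1)) S.σC 0 :=
  isRegularLevel_of_not_isMCriticalPt S.contMDiff_σC fun _ hz =>
    S.not_isMCriticalPt_of_comp_sheet S.contMDiff_σC (one_mul 1) (fun _ => one_mul _) hz

omit [T2Space W] in
/-- `τ_σ` is `C^∞`. [folklore] -/
theorem contMDiff_τ (σ : ℝ) : ContMDiff (𝓡 (n + 1)) 𝓘(ℝ, ℝ) ∞ (S.τ σ) :=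
  contMDiff_const.mul S.contMDiff_σC

/-- **`0` is a regular level of `τ_σ`** (`τ_σ ∘ j_{-σ} = S`). [folklore] -/
theorem isRegularLevel_τ {σ : ℝ} (hσ : σ * σ = 1) : IsRegularLevel (𝓡 (n + 1)) (S.τ σ) 0 := by
  have hσ' : (-σ) * (-σ) = 1 := by rw [neg_mul_neg, hσ]
  refine isRegularLevel_of_not_isMCriticalPt (S.contMDiff_τ σ) fun z hz => ?_
  have hz0 : S.σC z = 0 := by
    rcases mul_eq_zero.1 hz with h | h
    · exact absurd h (neg_ne_zero.2 (σ_ne_zero hσ))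
    · exact h
  refine S.not_isMCriticalPt_of_comp_sheet (S.contMDiff_τ σ) hσ' (fun w => ?_) hz0
  rw [τ_apply, σC_sheet, ← mul_assoc, show -σ * -σ = 1 from hσ', one_mul]

end Regular

/-! ### The pieces `U_σ = {σ s ≥ 0} ⊆ C` and the diffeomorphisms `W ≅ U_σ` -/

section Pieces

variable {n : ℕ} {W : Type u} [TopologicalSpace W] [T2Space W]
  [ChartedSpace (EuclideanHalfSpace (n + 1)) W] [IsManifold (𝓡∂ (n + 1)) ∞ W]
  (S : SheetData n W) {σ : ℝ} (hσ : σ * σ = 1)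

/-- **The piece `U_σ = {σ s ≥ 0}` of `C`**, a regular domain (manifold with boundary `{s = 0}`).
[folklore] -/
abbrev U : Type u := RegularSublevel (S.isRegularLevel_τ hσ)

/-- Points of `U_σ` satisfy `σ s ≥ 0`. [folklore] -/
theorem nonneg_of_U (z : S.U hσ) : 0 ≤ σ * S.σC (RegularSublevel.incl _ z) :=
  (S.τ_nonpos_iff σ _).1 (RegularSublevel.apply_incl_le _ z)

omit [T2Space W] in
/-- The sheet `j_σ` lands in `U_σ`. [folklore] -/
theorem τ_sheet_nonpos (w : W) : S.τ σ (S.sheet hσ w) ≤ 0 := by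
  rw [S.τ_nonpos_iff σ, S.σC_sheet, ← mul_assoc, hσ, one_mul]
  exact S.sCoord_nonneg w

/-- The sheet as a map into its piece `U_σ`. [folklore] -/
def toU (w : W) : S.U hσ := RegularSublevel.mk _ (S.sheet hσ w) (S.τ_sheet_nonpos hσ w)

/-- `incl ∘ toU = j_σ` (definitional). [folklore] -/
@[simp] theorem incl_toU (w : W) : RegularSublevel.incl _ (S.toU hσ w) = S.sheet hσ w := rfl

/-- The sheet is `C^∞` as a map into `U_σ` (smooth maps into a regular domain). [folklore] -/
theorem contMDiff_toU : ContMDiff (𝓡∂ (n + 1)) (𝓡∂ (n + 1)) ∞ (S.toU hσ) :=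
  (RegularSublevel.halfSliceAtlas (S.isRegularLevel_τ hσ)).contMDiff_codRestrict
    (fun w => S.τ_sheet_nonpos hσ w) (S.contMDiff_sheet hσ)

/-- The flow-back on the piece `U_σ`. [folklore] -/
def fromU (z : S.U hσ) : W := S.Ψ σ (RegularSublevel.incl _ z)

/-- `fromU ∘ toU = id`. [folklore] -/
theorem fromU_toU (w : W) : S.fromU hσ (S.toU hσ w) = w := S.Ψ_sheet hσ w

/-- `toU ∘ fromU = id`. [folklore] -/
theorem toU_fromU (z : S.U hσ) : S.toU hσ (S.fromU hσ z) = z :=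
  RegularSublevel.injective_incl _ (S.sheet_Ψ hσ (S.nonneg_of_U hσ z))

/-- The flow-back formula is jointly `C^∞` in `(q, s)` on `{g q < a} × {ν(σ s) ∈ [0, a]}`.
[folklore] -/
theorem contMDiffOn_ΨFormula :
    ContMDiffOn (prodModel n) (𝓡∂ (n + 1)) ∞
      (fun p : W × ℝ => S.Γ.Fl (S.Γ.ret p.1) (Profile.nu S.ε (σ * p.2)))
      ({q | S.D.f q < S.Γ.a} ×ˢ {s | Profile.nu S.ε (σ * s) ∈ Icc 0 S.Γ.a}) := by
  have hν : ContMDiff 𝓘(ℝ, ℝ) 𝓘(ℝ, ℝ) ∞ fun s : ℝ => Profile.nu S.ε (σ * s) :=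
    (Profile.contDiff_nu.comp (contDiff_const.mul contDiff_id)).contMDiff
  have h1 : ContMDiffOn (prodModel n) ((𝓡∂ (n + 1)).prod 𝓘(ℝ, ℝ)) ∞
      (fun p : W × ℝ => (S.Γ.ret p.1, Profile.nu S.ε (σ * p.2)))
      ({q | S.D.f q < S.Γ.a} ×ˢ {s | Profile.nu S.ε (σ * s) ∈ Icc 0 S.Γ.a}) :=
    (S.Γ.contMDiffOn_ret_lt.comp contMDiffOn_fst fun p hp => hp.1).prodMk
      (hν.comp_contMDiffOn contMDiffOn_snd)
  refine S.Γ.contMDiffOn_Fl.comp h1 ?_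
  rintro ⟨q, s⟩ ⟨hq, hs⟩
  refine ⟨?_, hs⟩
  show S.D.f (S.Γ.ret q) < S.Γ.a
  rw [S.Γ.f_ret (le_of_lt hq)]; exact S.Γ.a_pos

/-- **The flow-back is `C^∞` on `U_σ`**: near the seam it is the flow-back formula of
`(q, s)` (jointly smooth, the time `ν(σ s) ≥ 0` staying in `[0, a]` exactly because `σ s ≥ 0`
on `U_σ`), deep inside it is the base projection `q`. [folklore] -/
theorem contMDiff_fromU : ContMDiff (𝓡∂ (n + 1)) (𝓡∂ (n + 1)) ∞ (S.fromU hσ) := by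
  intro z₀
  have hincl : ContMDiff (𝓡∂ (n + 1)) (𝓡 (n + 1)) ∞
      (RegularSublevel.incl (S.isRegularLevel_τ hσ)) := RegularSublevel.contMDiff_incl _
  have hbase : ContMDiff (𝓡∂ (n + 1)) (prodModel n) ∞
      (fun z : S.U hσ => S.baseC (RegularSublevel.incl _ z)) := S.contMDiff_baseC.comp hincl
  have hg : Continuous fun z : S.U hσ => S.D.f (S.qC (RegularSublevel.incl _ z)) :=
    S.D.f_smooth.continuous.comp (S.contMDiff_qC.continuous.comp hincl.continuous)
  rcases lt_or_ge (S.ε + S.ε ^ 2 / 4) (S.D.f (S.qC (RegularSublevel.incl _ z₀))) with h | h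
  · -- deep inside: the base projection
    have hopen : IsOpen {z : S.U hσ | S.ε + S.ε ^ 2 / 4 < S.D.f (S.qC (RegularSublevel.incl _ z))} :=
      isOpen_lt continuous_const hg
    refine ((S.contMDiff_qC.comp hincl).contMDiffAt).congr_of_eventuallyEq ?_
    filter_upwards [hopen.mem_nhds h] with z hz
    exact S.Ψ_eq_qC hσ (S.nonneg_of_U hσ z) hz
  · -- near the seam: the flow-back formula
    have hlt : S.D.f (S.qC (RegularSublevel.incl _ z₀)) < S.Γ.a := lt_of_le_of_lt h S.bound_lt
    set O : Set (S.U hσ) := {z | S.D.f (S.qC (RegularSublevel.incl _ z)) < S.Γ.a} with hO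
    have hopen : IsOpen O := isOpen_lt hg continuous_const
    have hmaps : MapsTo (fun z : S.U hσ => S.baseC (RegularSublevel.incl _ z)) O
        ({q | S.D.f q < S.Γ.a} ×ˢ {s | Profile.nu S.ε (σ * s) ∈ Icc 0 S.Γ.a}) :=
      fun z hz => ⟨hz, S.nu_mem_Icc hσ (S.nonneg_of_U hσ z) hz⟩
    have hon : ContMDiffOn (𝓡∂ (n + 1)) (𝓡∂ (n + 1)) ∞
        ((fun p : W × ℝ => S.Γ.Fl (S.Γ.ret p.1) (Profile.nu S.ε (σ * p.2))) ∘
          fun z : S.U hσ => S.baseC (RegularSublevel.incl _ z)) O :=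
      (S.contMDiffOn_ΨFormula (σ := σ)).comp hbase.contMDiffOn hmaps
    refine (hon.contMDiffAt (hopen.mem_nhds hlt)).congr_of_eventuallyEq ?_
    filter_upwards [hopen.mem_nhds hlt] with z hz
    exact S.Ψ_of_lt hz

/-- **The diffeomorphism `W ≅ U_σ`** given by the sheet `j_σ` and the flow-back `Ψ_σ`. [folklore] -/
def sheetDiffeo : W ≃ₘ⟮𝓡∂ (n + 1), 𝓡∂ (n + 1)⟯ S.U hσ where
  toFun := S.toU hσ
  invFun := S.fromU hσ
  left_inv := S.fromU_toU hσ
  right_inv := S.toU_fromU hσ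
  contMDiff_toFun := S.contMDiff_toU hσ
  contMDiff_invFun := S.contMDiff_fromU hσ

/-- The diffeomorphism `W ≅ U_σ` is `toU` (definitional). [folklore] -/
@[simp] theorem sheetDiffeo_apply (w : W) : S.sheetDiffeo hσ w = S.toU hσ w := rfl

/-- **The sheets are smooth embeddings** (`j_σ = incl ∘ (W ≅ U_σ)`). [folklore] -/
theorem isSmoothEmbedding_sheet : Manifold.IsSmoothEmbedding (𝓡∂ (n + 1)) (𝓡 (n + 1)) ∞ (S.sheet hσ) := by
  set Φ := (S.sheetDiffeo hσ).toHomeomorph.toOpenPartialHomeomorph with hΦ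
  have h := (RegularSublevel.isSmoothEmbedding_incl (S.isRegularLevel_τ hσ)).comp_openPartialHomeomorph
    Φ rfl (S.sheetDiffeo hσ).contMDiff.contMDiffOn (S.sheetDiffeo hσ).symm.contMDiff.contMDiffOn
  exact h

end Pieces

end SheetData

namespace SheetData

/-! ### `C = ∂V` is the double of `W` -/

section Double

variable {n : ℕ} {W : Type u} [TopologicalSpace W] [T2Space W]
  [ChartedSpace (EuclideanHalfSpace (n + 1)) W] [IsManifold (𝓡∂ (n + 1)) ∞ W]
  (S : SheetData n W)

/-- `1 · 1 = 1` (the sign of the upper sheet). [folklore] -/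
theorem one_mul_one : (1 : ℝ) * 1 = 1 := one_mul 1

/-- `(-1) · (-1) = 1` (the sign of the lower sheet). [folklore] -/
theorem neg_one_mul_neg_one : (-1 : ℝ) * -1 = 1 := by norm_num

omit [T2Space W] in
/-- The retraction is the identity on the boundary. [folklore] -/
theorem ret_eq_self {w : W} (hw : w ∈ (𝓡∂ (n + 1)).boundary W) : S.Γ.ret w = w := by
  have h0 : S.D.f w = 0 := (S.D.f_eq_zero_iff w).2 hw
  show S.Γ.Fl w (-S.D.f w) = w
  rw [h0, neg_zero]
  exact S.Γ.Fl_zero (by rw [h0]; exact S.Γ.a_pos.le)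

/-- On the boundary the push is injective (`ret ∘ R = ret = id` there). [folklore] -/
theorem eq_of_push_eq {a a' : W} (ha : a ∈ (𝓡∂ (n + 1)).boundary W)
    (ha' : a' ∈ (𝓡∂ (n + 1)).boundary W) (h : S.push a = S.push a') : a = a' := by
  have ga : S.D.f a < S.Γ.a := by rw [(S.D.f_eq_zero_iff a).2 ha]; exact S.Γ.a_pos
  have ga' : S.D.f a' < S.Γ.a := by rw [(S.D.f_eq_zero_iff a').2 ha']; exact S.Γ.a_pos
  have := congrArg S.Γ.ret h
  rwa [S.ret_push ga, S.ret_push ga', S.ret_eq_self ha, S.ret_eq_self ha'] at this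

omit [T2Space W] in
/-- **The seam relation**: the upper and the lower sheet meet exactly along `∂W`, pointwise.
[folklore] -/
theorem sheet_eq_sheet_iff [T2Space W] {a a' : W} :
    S.sheet one_mul_one a = S.sheet neg_one_mul_neg_one a' ↔
      a = a' ∧ a ∈ (𝓡∂ (n + 1)).boundary W := by
  constructor
  · intro h
    have hb := congrArg S.baseC h
    simp only [baseC_sheet, one_mul, neg_mul, Prod.mk.injEq] at hb
    obtain ⟨hpush, hs⟩ := hb
    have h1 := S.sCoord_nonneg a
    have h2 := S.sCoord_nonneg a'
    have hsa : S.sCoord a = 0 := by linarith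
    have hsa' : S.sCoord a' = 0 := by linarith
    have hba := (S.sCoord_eq_zero_iff a).1 hsa
    have hba' := (S.sCoord_eq_zero_iff a').1 hsa'
    exact ⟨S.eq_of_push_eq hba hba' hpush, hba⟩
  · rintro ⟨rfl, ha⟩
    apply S.injective_baseC
    simp only [baseC_sheet, one_mul, neg_mul, (S.sCoord_eq_zero_iff a).2 ha, neg_zero]

/-- The two sheets cover `C`. [folklore] -/
theorem range_sheet_union :
    range (S.sheet one_mul_one) ∪ range (S.sheet neg_one_mul_neg_one) = univ := by
  rw [S.range_sheet, S.range_sheet]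
  apply eq_univ_of_forall
  intro z
  rcases le_total 0 (S.σC z) with h | h
  · left; show 0 ≤ 1 * S.σC z; linarith
  · right; show 0 ≤ -1 * S.σC z; linarith

/-- **`C = ∂V` is a double of `W`**: the two sheets are smooth embeddings of `W` covering `C` and
meeting exactly along `∂W` (identified by the identity). [cite: Kosinski1993, VI §5] -/
theorem isDouble (b : BoundaryData (𝓡∂ (n + 1)) W (𝓡 n)) : IsDouble b (𝓡 (n + 1)) S.C := by
  refine ⟨S.sheet one_mul_one, S.sheet neg_one_mul_neg_one, S.isSmoothEmbedding_sheet _,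
    S.isSmoothEmbedding_sheet _, S.range_sheet_union, fun a a' => ?_⟩
  rw [S.sheet_eq_sheet_iff]
  constructor
  · rintro ⟨rfl, ha⟩
    rw [← b.range_incl] at ha
    obtain ⟨z, rfl⟩ := ha
    exact ⟨z, rfl, rfl⟩
  · rintro ⟨z, rfl, h⟩
    exact ⟨h.symm, by rw [← b.range_incl]; exact mem_range_self z⟩

/-- **Any double of `W` is diffeomorphic to `C = ∂V`** (uniqueness of gluings,
`nonempty_diffeomorph_of_isBoundaryGluing_holds`). [cite: Kosinski1993, VI §5] -/
theorem nonempty_diffeomorph_of_isDouble [CompactSpace W] (b : BoundaryData (𝓡∂ (n + 1)) W (𝓡 n))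
    {P : Type u} [TopologicalSpace P] [ChartedSpace (𝔼 (n + 1)) P] [IsManifold (𝓡 (n + 1)) ∞ P]
    (hP : IsDouble b (𝓡 (n + 1)) P) : Nonempty (P ≃ₘ⟮𝓡 (n + 1), 𝓡 (n + 1)⟯ S.C) :=
  nonempty_diffeomorph_of_isBoundaryGluing_holds (bM := b) (bN := b) (P := P) (P' := S.C)
    (φ := Diffeomorph.refl (𝓡 n) b.carrier ∞) hP (S.isDouble b)

/-- **Any double of `W` embeds onto `∂V`.** [cite: Kosinski1993, VI §5] -/
theorem exists_isSmoothEmbedding_range_eq [CompactSpace W] (b : BoundaryData (𝓡∂ (n + 1)) W (𝓡 n))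
    {P : Type u} [TopologicalSpace P] [ChartedSpace (𝔼 (n + 1)) P] [IsManifold (𝓡 (n + 1)) ∞ P]
    (hP : IsDouble b (𝓡 (n + 1)) P) :
    ∃ φ : P → S.V, Manifold.IsSmoothEmbedding (𝓡 (n + 1)) (𝓡∂ (n + 1 + 1)) ∞ φ ∧
      range φ = (𝓡∂ (n + 1 + 1)).boundary S.V := by
  obtain ⟨e⟩ := S.nonempty_diffeomorph_of_isDouble b hP
  refine ⟨Subtype.val ∘ e, ?_, ?_⟩
  · exact (BoundaryManifold.isSmoothEmbedding_subtype_val (n := n + 1) (W := S.V)).comp_openPartialHomeomorph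
      e.toHomeomorph.toOpenPartialHomeomorph rfl e.contMDiff.contMDiffOn e.symm.contMDiff.contMDiffOn
  · have hr : range (⇑e) = univ := Set.range_eq_univ.2 fun z => ⟨e.symm z, e.apply_symm_apply z⟩
    rw [range_comp, hr, image_univ, Subtype.range_coe_subtype]
    rfl

end Double

/-! ### `V` deformation retracts onto `W`: the homotopy equivalence `V ≃ₕ W` -/

section HomotopyEquiv

variable {n : ℕ} {W : Type u} [TopologicalSpace W]
  [ChartedSpace (EuclideanHalfSpace (n + 1)) W] [IsManifold (𝓡∂ (n + 1)) ∞ W]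
  (S : SheetData n W)

/-- `vOf ∘ baseV = id`. [folklore] -/
theorem vOf_baseV (x : S.V) : S.vOf (S.baseV x) (S.isInteriorPoint_baseV x) (S.f_baseV_le x) = x :=
  S.injective_baseV rfl

/-- On `V`, `g q ≥ ε + s²`. [folklore] -/
theorem le_g_baseV (x : S.V) : S.ε + (S.baseV x).2 ^ 2 ≤ S.D.f (S.baseV x).1 := by
  rw [S.g_eq]; linarith [S.f_baseV_le x]

/-- Continuous maps into `V`. [folklore] -/
theorem continuous_vOf {X : Type*} [TopologicalSpace X] {p : X → W × ℝ} (hp : Continuous p)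
    (hint : ∀ x, (𝓡∂ (n + 1)).IsInteriorPoint (p x).1) (hle : ∀ x, S.f (p x).1 + (p x).2 ^ 2 ≤ 1 - S.ε) :
    Continuous fun x => S.vOf (p x) (hint x) (hle x) := by
  have h1 : Continuous fun x =>
      (⟨p x, isInteriorPoint_prod (hint x)⟩ : InteriorManifold (prodModel n) (W × ℝ)) :=
    InteriorManifold.continuous_iff_comp_val.2 hp
  have h2 : Continuous fun x => ambOf (p x) (hint x) := (Recharted.ofHomeomorph (L n)).continuous.comp h1
  exact h2.subtype_mk _

/-- The retraction `r : V → W`, `(w, s) ↦ w`. [folklore] -/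
def retr : C(S.V, W) :=
  ⟨fun x => (S.baseV x).1, continuous_fst.comp (Thickening.continuous_base _ _ _)⟩

/-- Unfolding the retraction `r`. [folklore] -/
@[simp] theorem retr_apply (x : S.V) : S.retr x = (S.baseV x).1 := rfl

/-- `(R w, 0) ∈ V`: `f (R w) + 0² ≤ 1 - ε`. [folklore] -/
theorem f_push_le (w : W) : S.f (S.push w) + (0 : ℝ) ^ 2 ≤ 1 - S.ε := by
  rw [S.f_push]; have := S.ε_le_lev w; nlinarith

variable [T2Space W]

/-- The section `i : W → V`, `w ↦ (R w, 0)`. [folklore] -/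
def sec : C(W, S.V) :=
  ⟨fun w => S.vOf (S.push w, 0) (S.isInteriorPoint_push w) (S.f_push_le w),
    S.continuous_vOf (S.continuous_push.prodMk continuous_const) _ _⟩

/-- The underlying point of `i(w)` is `(R w, 0)` (definitional). [folklore] -/
@[simp] theorem baseV_sec (w : W) : S.baseV (S.sec w) = (S.push w, 0) := rfl

/-- The homotopy `id ≃ R` on `W`. [folklore] -/
def pushHomotopy : ContinuousMap.Homotopy (ContinuousMap.id W) (S.retr.comp S.sec) where
  toFun p := S.pushHomotopyFun ((p.1 : ℝ), p.2)
  continuous_toFun := S.continuousOn_pushHomotopyFun.comp_continuous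
    (continuous_induced_dom.fst'.prodMk continuous_snd) fun p => ⟨p.1.2, mem_univ _⟩
  map_zero_left w := S.pushHomotopyFun_zero w
  map_one_left w := S.pushHomotopyFun_one w

omit [T2Space W] in
/-- The level data along the homotopy on `V`. [folklore] -/
theorem thickHomotopy_hyps (t : unitInterval) (x : S.V) :
    (𝓡∂ (n + 1)).IsInteriorPoint (S.pushHomotopyFun ((t : ℝ), (S.baseV x).1)) ∧
      S.f (S.pushHomotopyFun ((t : ℝ), (S.baseV x).1)) + ((1 - (t : ℝ)) * (S.baseV x).2) ^ 2 ≤ 1 - S.ε := by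
  have ht : (t : ℝ) ∈ Icc (0 : ℝ) 1 := t.2
  have h1 := S.f_le_f_pushHomotopyFun ht (S.baseV x).1
  have h2 := S.le_g_baseV x
  have hε := S.ε_pos
  constructor
  · refine ((𝓡∂ (n + 1)).isInteriorPoint_or_isBoundaryPoint _).resolve_right fun hb => ?_
    have h0 := (S.D.f_eq_zero_iff _).2 hb
    nlinarith
  · rw [S.f_eq']
    have hs : ((1 - (t : ℝ)) * (S.baseV x).2) ^ 2 ≤ (S.baseV x).2 ^ 2 := by
      rw [mul_pow]
      have h3 : (1 - (t : ℝ)) ^ 2 ≤ 1 := by nlinarith [ht.1, ht.2]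
      nlinarith [sq_nonneg (S.baseV x).2]
    linarith

/-- The homotopy `id ≃ i ∘ r` on `V`: `(q, s) ↦ (H(t, q), (1 - t) s)`. [folklore] -/
def thickHomotopy : ContinuousMap.Homotopy (ContinuousMap.id S.V) (S.sec.comp S.retr) where
  toFun p := S.vOf (S.pushHomotopyFun ((p.1 : ℝ), (S.baseV p.2).1), (1 - (p.1 : ℝ)) * (S.baseV p.2).2)
    (S.thickHomotopy_hyps p.1 p.2).1 (S.thickHomotopy_hyps p.1 p.2).2
  continuous_toFun := by
    refine S.continuous_vOf (Continuous.prodMk ?_ ?_) _ _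
    · exact S.continuousOn_pushHomotopyFun.comp_continuous
        (continuous_induced_dom.fst'.prodMk
          (continuous_fst.comp ((Thickening.continuous_base _ _ _).comp continuous_snd)))
        fun p => ⟨p.1.2, mem_univ _⟩
    · exact (continuous_const.sub continuous_induced_dom.fst').mul
        (continuous_snd.comp ((Thickening.continuous_base _ _ _).comp continuous_snd))
  map_zero_left x := by
    apply S.injective_baseV
    show (S.pushHomotopyFun (((0 : unitInterval) : ℝ), (S.baseV x).1),
      (1 - ((0 : unitInterval) : ℝ)) * (S.baseV x).2) = S.baseV x
    simp only [Set.Icc.coe_zero, sub_zero, one_mul, S.pushHomotopyFun_zero]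
  map_one_left x := by
    apply S.injective_baseV
    show (S.pushHomotopyFun (((1 : unitInterval) : ℝ), (S.baseV x).1),
      (1 - ((1 : unitInterval) : ℝ)) * (S.baseV x).2) = (S.push (S.baseV x).1, 0)
    simp only [Set.Icc.coe_one, sub_self, zero_mul, S.pushHomotopyFun_one]

/-- **`V ≃ₕ W`**: `V` deformation retracts onto the copy `{(R w, 0)}` of `W`.
[cite: FreedmanGompfMorrisonWalker2010, proof of Fact 2] -/
def homotopyEquiv : S.V ≃ₕ W where
  toFun := S.retr
  invFun := S.sec
  left_inv := ⟨S.thickHomotopy.symm⟩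
  right_inv := ⟨S.pushHomotopy.symm⟩

end HomotopyEquiv

/-! ### Handle counts and compactness of `V` -/

section Counts

variable {n : ℕ} {W : Type u} [TopologicalSpace W]
  [ChartedSpace (EuclideanHalfSpace (n + 1)) W] [IsManifold (𝓡∂ (n + 1)) ∞ W]
  (S : SheetData n W)

/-- The sublevel set `{f ≤ 1 - ε}` lies in the interior of `W`. [folklore] -/
theorem hint (w : W) (hw : S.f w ≤ 1 - S.ε) : (𝓡∂ (n + 1)).IsInteriorPoint w := by
  refine ((𝓡∂ (n + 1)).isInteriorPoint_or_isBoundaryPoint w).resolve_right fun hb => ?_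
  have h0 := (S.D.f_eq_zero_iff w).2 hb
  rw [S.g_eq] at h0
  linarith [S.ε_pos]

/-- **`V` is compact** when `W` is. [cite: FreedmanGompfMorrisonWalker2010, proof of Fact 2] -/
theorem compactSpace [CompactSpace W] : CompactSpace S.V :=
  Thickening.compactSpace (L n) S.isMorse S.ne_of_isMCriticalPt S.hint

/-- **`V` has one handle of index `i` for each critical point of `f` of index `i`.**
[cite: FreedmanGompfMorrisonWalker2010, proof of Fact 2] -/
theorem hasHandleDecomposition [T2Space W] :
    HasHandleDecomposition (n + 1) S.V fun i => (criticalSetOfIndex (𝓡∂ (n + 1)) S.f i).ncard := by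
  have h := Thickening.hasHandleDecomposition (L n) S.isMorse S.ne_of_isMCriticalPt S.hint
  have heq : (fun i => (criticalSetOfIndex (𝓡∂ (n + 1)) S.f i ∩ S.f ⁻¹' Iic (1 - S.ε)).ncard) =
      fun i => (criticalSetOfIndex (𝓡∂ (n + 1)) S.f i).ncard := by
    funext i
    rw [inter_eq_left.2]
    intro w hw
    exact (S.lt_of_isMCriticalPt w (criticalSetOfIndex_subset _ _ _ hw)).le
  rwa [heq] at h

/-- **`V` is a `k`-handlebody** when all critical points of `f` have index `≤ k`.
[cite: FreedmanGompfMorrisonWalker2010, proof of Fact 2] -/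
theorem isHandlebodyOfIndexLE [T2Space W] {k : ℕ}
    (hk : ∀ w, IsMCriticalPt (𝓡∂ (n + 1)) S.f w → morseIndex (𝓡∂ (n + 1)) S.f w ≤ k) :
    IsHandlebodyOfIndexLE (n + 1) k S.V :=
  Thickening.isHandlebodyOfIndexLE (L n) S.isMorse S.ne_of_isMCriticalPt fun w hw _ => hk w hw

end Counts

/-! ### Existence of sheet data for an adapted Morse function -/

section Existence

variable {n : ℕ} {W : Type u} [TopologicalSpace W] [T2Space W] [CompactSpace W]
  [ChartedSpace (EuclideanHalfSpace (n + 1)) W] [IsManifold (𝓡∂ (n + 1)) ∞ W]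

omit [T2Space W] in
/-- Critical values of an adapted Morse function on a compact manifold stay below some `c < 1`.
[folklore] -/
theorem _root_.Literature.Topology.FourManifolds.IsMorseAdapted.exists_lt_forall_isMCriticalPt
    {f : W → ℝ} (hf : IsMorseAdapted (𝓡∂ (n + 1)) f) :
    ∃ c < (1 : ℝ), ∀ w, IsMCriticalPt (𝓡∂ (n + 1)) f w → f w < c := by
  have hfin : (criticalSet (𝓡∂ (n + 1)) f).Finite := IsMorse.finite_criticalSet_holds hf.isMorse
  have hlt1 : ∀ w, IsMCriticalPt (𝓡∂ (n + 1)) f w → f w < 1 := fun w hw => by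
    refine hf.2.2 w (((𝓡∂ (n + 1)).isInteriorPoint_or_isBoundaryPoint w).resolve_right fun hb => ?_)
    exact (hf.2.1 w hb).2 hw
  rcases (criticalSet (𝓡∂ (n + 1)) f).eq_empty_or_nonempty with he | hne
  · refine ⟨0, one_pos, fun w hw => ?_⟩
    have : w ∈ criticalSet (𝓡∂ (n + 1)) f := hw
    rw [he] at this
    exact absurd this (notMem_empty w)
  · obtain ⟨w₀, hw₀, hmax⟩ := hfin.exists_maximalFor f _ hne
    refine ⟨(f w₀ + 1) / 2, by linarith [hlt1 w₀ hw₀], fun w hw => ?_⟩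
    have h1 : f w ≤ f w₀ := by
      by_contra hlt
      exact absurd (hmax hw (not_le.1 hlt).le) hlt
    linarith [hlt1 w₀ hw₀]

/-- **Sheet data exist** for every adapted Morse function on a compact manifold with boundary.
[folklore] -/
theorem _root_.Literature.Topology.FourManifolds.IsMorseAdapted.exists_sheetData
    {f : W → ℝ} (hf : IsMorseAdapted (𝓡∂ (n + 1)) f) : ∃ S : SheetData n W, S.f = f := by
  obtain ⟨c, hc1, hc⟩ := hf.exists_lt_forall_isMCriticalPt
  obtain ⟨D, hDf, -⟩ := exists_flowoutInput_of_boundary hf.1.1 (fun x hx => (hf.2.1 x hx).1) hf.2.2 hc1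
    (fun x hx hcrit => absurd (hc x hcrit) (not_lt.2 hx))
  obtain ⟨Γ⟩ := D.nonempty_cover
  set ε := min (min Γ.a 1 / 4) ((1 - c) / 2) with hε
  have hεpos : 0 < ε := by
    have := Γ.a_pos
    rw [hε]; refine lt_min ?_ (by linarith); positivity
  refine ⟨⟨⟨D, Γ, ε, hεpos, min_le_left _ _⟩, f, hf.isMorse, fun z => by rw [hDf], fun w hw => ?_⟩, rfl⟩
  have h1 := hc w hw
  have h2 : ε ≤ (1 - c) / 2 := min_le_right _ _
  linarith

end Existence

end SheetData

/-! ### The counted thickening theorem -/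

section Main

variable {n : ℕ} {W : Type u} [TopologicalSpace W] [T2Space W] [SecondCountableTopology W] [CompactSpace W]
  [ChartedSpace (EuclideanHalfSpace (n + 1)) W] [IsManifold (𝓡∂ (n + 1)) ∞ W]

/-- **The counted thickening of a compact manifold with boundary over its double.**  For a
compact `W` with an adapted Morse function `f`, a boundary datum `b` and a double `P` of `W`,
there is a compact `(n+2)`-manifold with boundary `V` — the thickening `{f + s² ≤ 1 - ε}` — with
`V ≃ₕ W`, one handle of index `i` for each critical point of `f` of index `i` (so a
`k`-handlebody if `f` has indices `≤ k`), and `P ≅ ∂V` by a smooth embedding onto `∂V`.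
[cite: FreedmanGompfMorrisonWalker2010, proof of Fact 2] -/
theorem exists_counted_thickening {f : W → ℝ} (hf : IsMorseAdapted (𝓡∂ (n + 1)) f)
    (b : BoundaryData (𝓡∂ (n + 1)) W (𝓡 n)) (P : Type u) [TopologicalSpace P]
    [ChartedSpace (𝔼 (n + 1)) P] [IsManifold (𝓡 (n + 1)) ∞ P] (hP : IsDouble b (𝓡 (n + 1)) P) :
    ∃ (V : Type u) (_ : TopologicalSpace V) (_ : T2Space V) (_ : SecondCountableTopology V)
      (_ : ChartedSpace (EuclideanHalfSpace (n + 1 + 1)) V)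
      (_ : IsManifold (𝓡∂ (n + 1 + 1)) ∞ V) (_ : CompactSpace V),
      Nonempty (V ≃ₕ W) ∧
      HasHandleDecomposition (n + 1) V (fun i => (criticalSetOfIndex (𝓡∂ (n + 1)) f i).ncard) ∧
      (∀ k, (∀ w, IsMCriticalPt (𝓡∂ (n + 1)) f w → morseIndex (𝓡∂ (n + 1)) f w ≤ k) →
        IsHandlebodyOfIndexLE (n + 1) k V) ∧
      ∃ φ : P → V, Manifold.IsSmoothEmbedding (𝓡 (n + 1)) (𝓡∂ (n + 1 + 1)) ∞ φ ∧
        Set.range φ = (𝓡∂ (n + 1 + 1)).boundary V := by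
  obtain ⟨S, rfl⟩ := hf.exists_sheetData
  haveI := S.compactSpace
  exact ⟨S.V, inferInstance, inferInstance, inferInstance, inferInstance, inferInstance, S.compactSpace,
    ⟨S.homotopyEquiv⟩, S.hasHandleDecomposition, fun k hk => S.isHandlebodyOfIndexLE hk,
    S.exists_isSmoothEmbedding_range_eq b hP⟩

end Main

end DoubleThickening

/-- **Discharge of `exists_countedThickening_of_isDouble`** (the double of a compact manifold with
boundary carrying an adapted Morse function with `c k` critical points of index `k` bounds a compact
manifold with boundary one dimension up, homotopy equivalent to it, with a handle decomposition with
the same counts): `DoubleThickening.exists_counted_thickening`.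
[cite: FreedmanGompfMorrisonWalker2010, proof of Fact 2] -/
theorem exists_countedThickening_of_isDouble_holds : exists_countedThickening_of_isDouble := by
  intro n c W _ _ _ _ _ _ hW b P _ _ _ _ _ hP
  obtain ⟨f, hf, hc⟩ := hW
  obtain ⟨V, i₁, i₂, i₃, i₄, i₅, i₆, he, hV, -, hφ⟩ := DoubleThickening.exists_counted_thickening hf b P hP
  have heq : (fun i => (criticalSetOfIndex (𝓡∂ (n + 1)) f i).ncard) = c := funext hc
  exact ⟨V, i₁, i₂, i₃, i₄, i₅, i₆, he, heq ▸ hV, hφ⟩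

/-- **Discharge of `exists_thickening_of_isDouble`** (the double of a compact `k`-handlebody bounds
a compact `k`-handlebody one dimension up, homotopy equivalent to it):
`DoubleThickening.exists_counted_thickening`. [cite: FreedmanGompfMorrisonWalker2010, proof of Fact 2] -/
theorem exists_thickening_of_isDouble_holds : exists_thickening_of_isDouble := by
  intro n k W _ _ _ _ _ _ hW b P _ _ _ _ _ hP
  obtain ⟨f, hf, hk⟩ := hW
  obtain ⟨V, i₁, i₂, i₃, i₄, i₅, i₆, he, -, hkV, hφ⟩ := DoubleThickening.exists_counted_thickening hf b P hP
  exact ⟨V, i₁, i₂, i₃, i₄, i₅, i₆, he, hkV k hk, hφ⟩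

end Literature.Topology.FourManifolds

end
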